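import Summits.CriticalPhenomena.PercolationContinuityZ3.Theorems.Transplant.SkelPhiRootNumbersX6
import Summits.CriticalPhenomena.PercolationContinuityZ3.Theorems.Transplant.SkelPhiRootDiam
import Summits.CriticalPhenomena.PercolationContinuityZ3.Theorems.Transplant.SkelNegBParamsSlotsS
import Summits.CriticalPhenomena.PercolationContinuityZ3.Theorems.Transplant.SkelPhiRootRoomsB
import Summits.CriticalPhenomena.PercolationContinuityZ3.Theorems.Transplant.SkelPhiRootServe
import Summits.CriticalPhenomena.PercolationContinuityZ3.Theorems.Transplant.SkelPhiRootServeTable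
import Summits.CriticalPhenomena.PercolationContinuityZ3.Theorems.Transplant.SkelPhiCylRadOri
import Summits.CriticalPhenomena.PercolationContinuityZ3.Theorems.Transplant.SkelNegBChoiceAllT
import Summits.CriticalPhenomena.PercolationContinuityZ3.Theorems.Transplant.SkelNegBParamsSlotsRS
import Summits.CriticalPhenomena.PercolationContinuityZ3.Theorems.Transplant.SkelNegBParamsSlots
import Summits.CriticalPhenomena.PercolationContinuityZ3.Theorems.Transplant.SkelNegBParamsExcess
import Summits.CriticalPhenomena.PercolationContinuityZ3.Theorems.Transplant.SkelPhiConcFaceRoute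
import HarnessLib

/-!
# N1 (the `{±1}` node), (R) column ((R6c), x-directions): **THE ROOT RESIDUE OF THE S1 CHOICES OF RECORD AT AN x-DIRECTION, FROM `AtQO`** —
# `PlanarSkeletonNeg.NegB.rootOblTWAt_negBT_x` (v3, NEG-SCOPE B.17: near-root footprints read by the two LATTICE FUNCTIONALS (L-R2′), run clearance read off the REGIONS with `hclr : k < σ·yL 0 − q_B − RA′ − n_L` (L-R3); located (L-R1), lane INBOX 2026-08-21T19:03Z: the root excess is taken for habitats of the FIBRE DIAMETER `mR … mx` — the root world's planar diameter in the fine map is `≤ 40·rmax` (`Skelφ.ψ_sub_mem_box_of_mem_U0rootb`), converted by stmt-g14's `fine_diam_le_mR` — instead of the ball's `2·Rπ`; one extra slot `mx`, and `hR₁b/hR₁r` now read `Rex κ Φ (mR … mx) q (fatRadius k) ≤ Rπ − r₀`, stmt-g14's `Rex_fat_le_Rπ_sub` shape): at every `(O, q)` with `(choiceAtOT …).AtQO O q` (T choices of record, `b0T = r/4`), one vertex type, for a direction `du` along the cells' axis `0`, `Skel.RootOblTWAt G ((choiceAtOT …).scheme O q) Φ.Δ κ.δr du` — by `Skelφ.rootOblTWAt_of_numbers6_x`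 with EVERYTHING STRUCTURAL DISCHARGED from the ledger (stmt-g14's `NegB`/`NegB.KS` chain): the long map `φL` and its frames, the fine map of record `fineO` (= `fineSkel φL t 800 n_L h_L v_L vβ …`), the root world / small target box of the twin scheme (`mem_U0rootb_of_footprint`, `mem_rootMb_of_footprint`), the pinned seed `Λ t k` (fat seed: contains `t`, internally connected, inside `B(t, fatRadius k)` and the root cube), BOTH apron kits (`KS.apron`, `apron_ok/sizes`, `hr₀/hreach_apron`, `levels_wide`, counts `counts_atq` at `δr`), the kit pair's region/table (`QKO`, `RgO_QKO`, `pexXO_facts`), ALL Step-I″ inputs at every centre (`…At_of_atQOB` transported, `real_pexRO_gt/real_pexXO_gt` through the tables, the hop at the root), the excess radius (`NegB.Rex` at the fibre diameter `mR`, `hR₁_at`) and the root world's planar diameter (`ψ_sub_mem_box_of_mem_U0rootb` + `fine_diam_le_mR`).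
# WHAT REMAINS AS HYPOTHESES (for stmt-g14's slot values / FEASIBILITY): the slots `mk, Nr, qB, Rπ, yL, Rb, mx` and the bridge data `B, Qb, Fb` (three orientation cases, instantiated by the companion from `inputsBR_of_atQOS` + `bridgeSets_*`), the four root radii, the zone-in-kit-prism inclusion, and INTEGER INEQUALITIES.

builds on p205010 (kernel theorem, internal audit signed; external expert review pending) — nothing in this file uses p205010; NOTHING is claimed about the open node `SamePDropOfSkeletonNeg₁`: this is the (R) residue of `samePDropOfSkeletonNeg₁_of_choiceFnNOW` at the x-directions modulo the listed numbers.
Lane `prim-bschramm`, seat `prim-bschramm-p3` (gen 10; design owner + (R) owner); helper file (`--supports stmt-CriticalPhenomena-4575 --as helper`).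
[cite: KozmaNitzan2024, §4 Theorem 6 (pp. 25–31), p. 28 ((32) at the root), Lemma 10–12] [cite: MartineauTassion2017, §3.2, §4.3]
-/

noncomputable section

open scoped Classical

namespace Summit.CriticalPhenomena.PercolationContinuityZ3.Theorems.Transplant

open MeasureTheory Literature.Probability.Percolation Literature.Probability.LatticeModels SimpleGraph KNCells KNLevels
open Literature.Probability.Percolation.KozmaNitzan.Cells (oth sgOf sgOf_sign stepVec_apply_fst)
open Literature.Barriers.CriticalPhenomena (graphBall mem_graphBall_self graphBall_mono)
open BoxProdZ2 (ConcRadiiG)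

namespace PlanarSkeletonNeg

open SkelConc (Consts)
open Skelφ (oriφ trφ FootBox rootFrame runX xRunSched RgO pexRO pexXO ShortPcO shearUnit pgramPrismFin pgSideHalfW)
open Skelφ.StepI (DataN OutO eventNAt)
open ChainPlanar (BridgePrm BridgeOK)
open SkelI (tanOff)

namespace NegB

open Neg

section AtQ

variable {κ : Consts} {V : Type} [DecidableEq V] [Countable V] {G : SimpleGraph V} [G.LocallyFinite] {Φ : PlanarSkeletonNeg G} {t : V} {p : unitInterval}
  {hC : Φ.CylSubcritical p} {gv fv : Neg.FSlot} {Pv : PSlot} {Sv : SSlot} {O : OutO V} {q : unitInterval}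

set_option maxHeartbeats 800000 in
/-- **THE ROOT RESIDUE OF THE S1 CHOICES OF RECORD AT AN x-DIRECTION** (T-variant of record: `choiceAtOT`, arrival boxes `b0T = r/4`, NEG-SCOPE B.16; see the module docstring).
[cite: KozmaNitzan2024, §4 p. 28 ((32) at the root), Lemma 10–12 (pp. 17–25)] -/
theorem rootOblTWAt_negBT_x (hAt : (choiceAtOT κ Φ t p gv fv Sv hC Pv).AtQO O q) (h1 : Φ.types = {t}) (hp0 : 0 < (p : ℝ)) (hp1 : (p : ℝ) < 1)
    (du : MDir) (mk Nr qB Rπ Rb : ℕ) (hNr : 0 + 1 + Nr ≤ 1000) (yL : Site 2) (mx : ℕ)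
    -- the two extra pairs are listed
    (hPk : (KS.MK O.merged mk, KS.nKit O.merged mk) ∈ (Pv κ Φ t p O.merged).1)
    -- the root radii of the fibre schedule of record
    (hRQ : Rπ + 1 ≤ (schedOf κ Φ t p O.merged (gOf κ Φ t p O gv) (fOf κ Φ t p O fv) (Sv κ Φ t p O.merged (gOf κ Φ t p O gv) (fOf κ Φ t p O fv) q)).rQ 0 0)
    (hRB : Rπ + 1 ≤ (schedOf κ Φ t p O.merged (gOf κ Φ t p O gv) (fOf κ Φ t p O fv) (Sv κ Φ t p O.merged (gOf κ Φ t p O gv) (fOf κ Φ t p O fv) q)).rB 0 0 du)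
    (hRQ' : Rπ + 1 ≤ (schedOf κ Φ t p O.merged (gOf κ Φ t p O gv) (fOf κ Φ t p O fv) (Sv κ Φ t p O.merged (gOf κ Φ t p O gv) (fOf κ Φ t p O fv) q)).rQ 0 ((0 : Site 2) + stepVec du))
    (hRM : Rπ + 1 ≤ (schedOf κ Φ t p O.merged (gOf κ Φ t p O gv) (fOf κ Φ t p O fv) (Sv κ Φ t p O.merged (gOf κ Φ t p O gv) (fOf κ Φ t p O fv) q)).rM 0 ((0 : Site 2) + stepVec du))
    -- the zone lies in the kit pair's prism at every centre
    (hΛRg : ∀ c, O.merged.Λ c (Mu O.merged) ⊆ KS.RgK G t O.merged mk (KS.φK Φ t O.D O.DT O.ori mk) c)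
    -- the seed's fine footprint: `|φL a − φL t| ≤ k` read by `kA` into the root cube
    {kA : ℤ} (hkA0 : 20 * (((fcells κ Φ t p O.merged (gOf κ Φ t p O gv) (fOf κ Φ t p O fv))).K : ℤ) * (((fcells κ Φ t p O.merged (gOf κ Φ t p O gv) (fOf κ Φ t p O fv))).s 0 : ℤ) * (|(800 : ℤ)| * (|(Skelφ.NegPrm.vβOf (nL κ Φ t p O.merged (gOf κ Φ t p O gv) (fOf κ Φ t p O fv)) (hL κ Φ t p O.merged (gOf κ Φ t p O gv) (fOf κ Φ t p O fv)) (ℓL κ Φ t p O.merged (gOf κ Φ t p O gv) (fOf κ Φ t p O fv)) (vL κ Φ t p O.merged (gOf κ Φ t p O gv) (fOf κ Φ t p O fv)))| + |(vL κ Φ t p O.merged (gOf κ Φ t p O gv) (fOf κ Φ t p O fv))|) * (O.merged.k : ℤ)) ≤ kA * (Skelφ.NegPrm.Dof (nL κ Φ t p O.merged (gOf κ Φ t p O gv) (fOf κ Φ t p O fv)) (hL κ Φ t p O.merged (gOf κ Φ t p O gv) (fOf κ Φ t p O fv)) (ℓL κ Φ t p O.merged (gOf κ Φ t p O gv) (fOf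 κ Φ t p O fv)) (vL κ Φ t p O.merged (gOf κ Φ t p O gv) (fOf κ Φ t p O fv))))
    (hkA1 : 20 * (((fcells κ Φ t p O.merged (gOf κ Φ t p O gv) (fOf κ Φ t p O fv))).K : ℤ) * (((fcells κ Φ t p O.merged (gOf κ Φ t p O gv) (fOf κ Φ t p O fv))).s 1 : ℤ) * (|(800 : ℤ)| * (|(((nL κ Φ t p O.merged (gOf κ Φ t p O gv) (fOf κ Φ t p O fv)) : ℕ) : ℤ)| + |(hL κ Φ t p O.merged (gOf κ Φ t p O gv) (fOf κ Φ t p O fv))|) * (O.merged.k : ℤ)) ≤ kA * (Skelφ.NegPrm.Dof (nL κ Φ t p O.merged (gOf κ Φ t p O gv) (fOf κ Φ t p O fv)) (hL κ Φ t p O.merged (gOf κ Φ t p O gv) (fOf κ Φ t p O fv)) (ℓL κ Φ t p O.merged (gOf κ Φ t p O gv) (fOf κ Φ t p O fv)) (vL κ Φ t p O.merged (gOf κ Φ t p O gv) (fOf κ Φ t p O fv))))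
    (hkAQ : kA + 1 ≤ 5 * (((fcells κ Φ t p O.merged (gOf κ Φ t p O gv) (fOf κ Φ t p O fv))).r du.1 : ℤ) ∧ kA + 1 ≤ 5 * (((fcells κ Φ t p O.merged (gOf κ Φ t p O gv) (fOf κ Φ t p O fv))).r (oth du.1) : ℤ))
    (hρπ : Skelφ.fatRadius Φ.frame hC O.merged.k ≤ Rπ)
    -- the bridge frame and the bridge stride (any of the three orientation cases of NEG-SCOPE B.13)
    (B : BridgePrm) (hB : BridgeOK B) (hBR' : KS.RA' κ Φ t p O.merged mk ≤ B.R')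
    (Qb Fb : V → Finset V)
    (hQb : ∀ c, ∀ w ∈ Qb c, w ∈ graphBall G c Rb ∧
      rootFrame (φL κ Φ t p O.D O.DT O.ori (gOf κ Φ t p O gv) (fOf κ Φ t p O fv)) t (sgOf du) w ∈ Finset.Icc (rootFrame (φL κ Φ t p O.D O.DT O.ori (gOf κ Φ t p O gv) (fOf κ Φ t p O fv)) t (sgOf du) c - ((B.pr : ℕ) : Site 2)) (rootFrame (φL κ Φ t p O.D O.DT O.ori (gOf κ Φ t p O gv) (fOf κ Φ t p O fv)) t (sgOf du) c + ((B.pr : ℕ) : Site 2)))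
    (hFb : ∀ c, ∀ w ∈ Fb c, w ∈ Qb c ∧ rootFrame (φL κ Φ t p O.D O.DT O.ori (gOf κ Φ t p O gv) (fOf κ Φ t p O fv)) t (sgOf du) w ∈ Finset.Icc (rootFrame (φL κ Φ t p O.D O.DT O.ori (gOf κ Φ t p O gv) (fOf κ Φ t p O fv)) t (sgOf du) c + B.dlo) (rootFrame (φL κ Φ t p O.D O.DT O.ori (gOf κ Φ t p O gv) (fOf κ Φ t p O fv)) t (sgOf du) c + B.dhi))
    (hFZ : ∀ c, Disjoint (Fb c) (O.merged.Λ c (Mu O.merged)))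
    (hbridge : ∀ c, 1 - κ.δr (0 + 1 + Nr) ^ 2 < (bondPercolation G q).real (linkIn (↑(Qb c) : Set V) (O.merged.Λ c O.merged.k) (Fb c)))
    -- ROOM NUMBERS (a): the hop's landing box inside core `0` of the bridge; the long prism inside the window
    (hB0 : Finset.Icc (Skelφ.pt (nL κ Φ t p O.merged (gOf κ Φ t p O gv) (fOf κ Φ t p O fv)) (sgOf du * (hL κ Φ t p O.merged (gOf κ Φ t p O gv) (fOf κ Φ t p O fv)))) (Skelφ.pt (nL κ Φ t p O.merged (gOf κ Φ t p O gv) (fOf κ Φ t p O fv)) (sgOf du * (hL κ Φ t p O.merged (gOf κ Φ t p O gv) (fOf κ Φ t p O fv)) + (ℓL κ Φ t p O.merged (gOf κ Φ t p O gv) (fOf κ Φ t p O fv)))) ⊆ Finset.Icc B.B₀lo B.B₀hi) (hRlπ : (O.merged.R (O.merged.scale t (ML κ Φ t p O.merged (gOf κ Φ t p O gv)) (nL κ Φ t p O.merged (gOf κ Φ t p O gv) (fOf κ Φ t p O fv)))) ≤ Rπ)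
    -- ROOM NUMBERS (b): near-root reach of the bridge region and the hop prism, READ BY THE TWO LATTICE FUNCTIONALS `Λ₀ = |vβΔ₀ − vαΔ₁|`, `Λ₁ = |nΔ₁ − hΔ₀|` (B.17 (L-R2′))
    {Λ₀ Λ₁ kR₀ kR₁ : ℤ}
    (hΛR : ∀ x ∈ Finset.Icc B.regionLo B.regionHi, |(Skelφ.NegPrm.vβOf (nL κ Φ t p O.merged (gOf κ Φ t p O gv) (fOf κ Φ t p O fv)) (hL κ Φ t p O.merged (gOf κ Φ t p O gv) (fOf κ Φ t p O fv)) (ℓL κ Φ t p O.merged (gOf κ Φ t p O gv) (fOf κ Φ t p O fv)) (vL κ Φ t p O.merged (gOf κ Φ t p O gv) (fOf κ Φ t p O fv))) * (sgOf du * x 0) - (vL κ Φ t p O.merged (gOf κ Φ t p O gv) (fOf κ Φ t p O fv)) * x 1| ≤ Λ₀ ∧ |(((nL κ Φ t p O.merged (gOf κ Φ t p O gv) (fOf κ Φ t p O fv)) : ℕ) : ℤ) * x 1 - (hL κ Φ t p O.merged (gOf κ Φ t p O gv) (fOf κ Φ t p O fv)) * (sgOf du * x 0)| ≤ Λ₁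)
    (hΛQ0 : TwoAxis.Para.modulus (nL κ Φ t p O.merged (gOf κ Φ t p O gv) (fOf κ Φ t p O fv)) (hL κ Φ t p O.merged (gOf κ Φ t p O gv) (fOf κ Φ t p O fv)) (vL κ Φ t p O.merged (gOf κ Φ t p O gv) (fOf κ Φ t p O fv)) (Skelφ.NegPrm.vβOf (nL κ Φ t p O.merged (gOf κ Φ t p O gv) (fOf κ Φ t p O fv)) (hL κ Φ t p O.merged (gOf κ Φ t p O gv) (fOf κ Φ t p O fv)) (ℓL κ Φ t p O.merged (gOf κ Φ t p O gv) (fOf κ Φ t p O fv)) (vL κ Φ t p O.merged (gOf κ Φ t p O gv) (fOf κ Φ t p O fv))) + (((nL κ Φ t p O.merged (gOf κ Φ t p O gv) (fOf κ Φ t p O fv)) : ℕ) : ℤ) * ((3 * (ℓL κ Φ t p O.merged (gOf κ Φ t p O gv) (fOf κ Φ t p O fv)) : ℕ) : ℤ) ≤ Λ₀) (hΛQ1 : (((nL κ Φ t p O.merged (gOf κ Φ t p O gv) (fOf κ Φ t p O fv)) : ℕ) : ℤ) * ((3 * (ℓL κ Φ t p O.merged (gOf κ Φ t p O gv) (fOf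 κ Φ t p O fv)) : ℕ) : ℤ) ≤ Λ₁)
    (hkR0 : 20 * (((fcells κ Φ t p O.merged (gOf κ Φ t p O gv) (fOf κ Φ t p O fv))).K : ℤ) * (((fcells κ Φ t p O.merged (gOf κ Φ t p O gv) (fOf κ Φ t p O fv))).s 0 : ℤ) * (|(800 : ℤ)| * Λ₀) ≤ kR₀ * (Skelφ.NegPrm.Dof (nL κ Φ t p O.merged (gOf κ Φ t p O gv) (fOf κ Φ t p O fv)) (hL κ Φ t p O.merged (gOf κ Φ t p O gv) (fOf κ Φ t p O fv)) (ℓL κ Φ t p O.merged (gOf κ Φ t p O gv) (fOf κ Φ t p O fv)) (vL κ Φ t p O.merged (gOf κ Φ t p O gv) (fOf κ Φ t p O fv))))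
    (hkR1 : 20 * (((fcells κ Φ t p O.merged (gOf κ Φ t p O gv) (fOf κ Φ t p O fv))).K : ℤ) * (((fcells κ Φ t p O.merged (gOf κ Φ t p O gv) (fOf κ Φ t p O fv))).s 1 : ℤ) * (|(800 : ℤ)| * Λ₁) ≤ kR₁ * (Skelφ.NegPrm.Dof (nL κ Φ t p O.merged (gOf κ Φ t p O gv) (fOf κ Φ t p O fv)) (hL κ Φ t p O.merged (gOf κ Φ t p O gv) (fOf κ Φ t p O fv)) (ℓL κ Φ t p O.merged (gOf κ Φ t p O gv) (fOf κ Φ t p O fv)) (vL κ Φ t p O.merged (gOf κ Φ t p O gv) (fOf κ Φ t p O fv))))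
    (hfR0 : du.1 = 0 → -(5 * (((fcells κ Φ t p O.merged (gOf κ Φ t p O gv) (fOf κ Φ t p O fv))).r du.1 : ℤ)) + 1 ≤ -kR₀ ∧ kR₀ ≤ 25 * (((fcells κ Φ t p O.merged (gOf κ Φ t p O gv) (fOf κ Φ t p O fv))).r du.1 : ℤ) - 1 ∧ kR₁ ≤ 5 * (((fcells κ Φ t p O.merged (gOf κ Φ t p O gv) (fOf κ Φ t p O fv))).r (oth du.1) : ℤ) - 2)
    (hfR1 : du.1 = 1 → -(5 * (((fcells κ Φ t p O.merged (gOf κ Φ t p O gv) (fOf κ Φ t p O fv))).r du.1 : ℤ)) + 1 ≤ -kR₁ ∧ kR₁ ≤ 25 * (((fcells κ Φ t p O.merged (gOf κ Φ t p O gv) (fOf κ Φ t p O fv))).r du.1 : ℤ) - 1 ∧ kR₀ ≤ 5 * (((fcells κ Φ t p O.merged (gOf κ Φ t p O gv) (fOf κ Φ t p O fv))).r (oth du.1) : ℤ) - 2)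
    -- ROOM NUMBERS (c): the run's prism and last core as x-frame boxes and their fine readings (root world / small target box)
    {paLo pbLo paHi pbHi laLo lbLo laHi lbHi : ℤ}
    (hprism : (xRunSched (nL κ Φ t p O.merged (gOf κ Φ t p O gv) (fOf κ Φ t p O fv)) (ℓL κ Φ t p O.merged (gOf κ Φ t p O gv) (fOf κ Φ t p O fv)) (hL κ Φ t p O.merged (gOf κ Φ t p O gv) (fOf κ Φ t p O fv)) (KS.RA' κ Φ t p O.merged mk) qB Nr).prism ⊆ Finset.Icc (Skelφ.pt paLo pbLo) (Skelφ.pt paHi pbHi))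
    (hlastc : (xRunSched (nL κ Φ t p O.merged (gOf κ Φ t p O gv) (fOf κ Φ t p O fv)) (ℓL κ Φ t p O.merged (gOf κ Φ t p O gv) (fOf κ Φ t p O fv)) (hL κ Φ t p O.merged (gOf κ Φ t p O gv) (fOf κ Φ t p O fv)) (KS.RA' κ Φ t p O.merged mk) qB Nr).core (Nr + 1) ⊆ Finset.Icc (Skelφ.pt laLo lbLo) (Skelφ.pt laHi lbHi))
    {PLO PHI LLO LHI : Site 2}
    (hP0 : PLO 0 ≤ TwoAxis.Para.coarse (20 * (((fcells κ Φ t p O.merged (gOf κ Φ t p O gv) (fOf κ Φ t p O fv))).K : ℤ) * (((fcells κ Φ t p O.merged (gOf κ Φ t p O gv) (fOf κ Φ t p O fv))).s 0 : ℤ)) ((Skelφ.NegPrm.Dof (nL κ Φ t p O.merged (gOf κ Φ t p O gv) (fOf κ Φ t p O fv)) (hL κ Φ t p O.merged (gOf κ Φ t p O gv) (fOf κ Φ t p O fv)) (ℓL κ Φ t p O.merged (gOf κ Φ t p O gv) (fOf κ Φ t p O fv)) (vL κ Φ t p O.merged (gOf κ Φ t p O gv) (fOf κ Φ t p O fv)))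 / 2) (Skelφ.NegPrm.Dof (nL κ Φ t p O.merged (gOf κ Φ t p O gv) (fOf κ Φ t p O fv)) (hL κ Φ t p O.merged (gOf κ Φ t p O gv) (fOf κ Φ t p O fv)) (ℓL κ Φ t p O.merged (gOf κ Φ t p O gv) (fOf κ Φ t p O fv)) (vL κ Φ t p O.merged (gOf κ Φ t p O gv) (fOf κ Φ t p O fv))) (TwoAxis.Para.lam0 800 (vL κ Φ t p O.merged (gOf κ Φ t p O gv) (fOf κ Φ t p O fv)) (Skelφ.NegPrm.vβOf (nL κ Φ t p O.merged (gOf κ Φ t p O gv) (fOf κ Φ t p O fv)) (hL κ Φ t p O.merged (gOf κ Φ t p O gv) (fOf κ Φ t p O fv)) (ℓL κ Φ t p O.merged (gOf κ Φ t p O gv) (fOf κ Φ t p O fv)) (vL κ Φ t p O.merged (gOf κ Φ t p O gv) (fOf κ Φ t p O fv))) yL) +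
      (20 * (((fcells κ Φ t p O.merged (gOf κ Φ t p O gv) (fOf κ Φ t p O fv))).K : ℤ) * (((fcells κ Φ t p O.merged (gOf κ Φ t p O gv) (fOf κ Φ t p O fv))).s 0 : ℤ) * (800 * (TwoAxis.Para.modulus (nL κ Φ t p O.merged (gOf κ Φ t p O gv) (fOf κ Φ t p O fv)) (hL κ Φ t p O.merged (gOf κ Φ t p O gv) (fOf κ Φ t p O fv)) (vL κ Φ t p O.merged (gOf κ Φ t p O gv) (fOf κ Φ t p O fv)) (Skelφ.NegPrm.vβOf (nL κ Φ t p O.merged (gOf κ Φ t p O gv) (fOf κ Φ t p O fv)) (hL κ Φ t p O.merged (gOf κ Φ t p O gv) (fOf κ Φ t p O fv)) (ℓL κ Φ t p O.merged (gOf κ Φ t p O gv) (fOf κ Φ t p O fv)) (vL κ Φ t p O.merged (gOf κ Φ t p O gv) (fOf κ Φ t p O fv))) * (min (sgOf du * paLo) (sgOf du * paHi)) -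
        max ((vL κ Φ t p O.merged (gOf κ Φ t p O gv) (fOf κ Φ t p O fv)) * ((shearUnit (nL κ Φ t p O.merged (gOf κ Φ t p O gv) (fOf κ Φ t p O fv)) (hL κ Φ t p O.merged (gOf κ Φ t p O gv) (fOf κ Φ t p O fv)) : ℤ) * (min (sgOf du * pbLo) (sgOf du * pbHi) - 1))) ((vL κ Φ t p O.merged (gOf κ Φ t p O gv) (fOf κ Φ t p O fv)) * ((shearUnit (nL κ Φ t p O.merged (gOf κ Φ t p O gv) (fOf κ Φ t p O fv)) (hL κ Φ t p O.merged (gOf κ Φ t p O gv) (fOf κ Φ t p O fv)) : ℤ) * (max (sgOf du * pbLo) (sgOf du * pbHi)) + shearUnit (nL κ Φ t p O.merged (gOf κ Φ t p O gv) (fOf κ Φ t p O fv)) (hL κ Φ t p O.merged (gOf κ Φ t p O gv) (fOf κ Φ t p O fv)) - 1))) / (nL κ Φ t p O.merged (gOf κ Φ t p O gv) (fOf κ Φ t p O fv)))) / (Skelφ.NegPrm.Dof (nL κ Φ t p O.merged (gOf κ Φ t p O gv) (fOf κ Φ t p O fv)) (hL κ Φ t p O.merged (gOf κ Φ t p O gv)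 (fOf κ Φ t p O fv)) (ℓL κ Φ t p O.merged (gOf κ Φ t p O gv) (fOf κ Φ t p O fv)) (vL κ Φ t p O.merged (gOf κ Φ t p O gv) (fOf κ Φ t p O fv))))
    (hP1 : TwoAxis.Para.coarse (20 * (((fcells κ Φ t p O.merged (gOf κ Φ t p O gv) (fOf κ Φ t p O fv))).K : ℤ) * (((fcells κ Φ t p O.merged (gOf κ Φ t p O gv) (fOf κ Φ t p O fv))).s 0 : ℤ)) ((Skelφ.NegPrm.Dof (nL κ Φ t p O.merged (gOf κ Φ t p O gv) (fOf κ Φ t p O fv)) (hL κ Φ t p O.merged (gOf κ Φ t p O gv) (fOf κ Φ t p O fv)) (ℓL κ Φ t p O.merged (gOf κ Φ t p O gv) (fOf κ Φ t p O fv)) (vL κ Φ t p O.merged (gOf κ Φ t p O gv) (fOf κ Φ t p O fv))) / 2) (Skelφ.NegPrm.Dof (nL κ Φ t p O.merged (gOf κ Φ t p O gv) (fOf κ Φ t p O fv)) (hL κ Φ t p O.merged (gOf κ Φ t p O gv) (fOf κ Φ t p O fv)) (ℓL κ Φ t p O.merged (gOf κ Φ t p O gv) (fOf κ Φ t p O fv))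 (vL κ Φ t p O.merged (gOf κ Φ t p O gv) (fOf κ Φ t p O fv))) (TwoAxis.Para.lam0 800 (vL κ Φ t p O.merged (gOf κ Φ t p O gv) (fOf κ Φ t p O fv)) (Skelφ.NegPrm.vβOf (nL κ Φ t p O.merged (gOf κ Φ t p O gv) (fOf κ Φ t p O fv)) (hL κ Φ t p O.merged (gOf κ Φ t p O gv) (fOf κ Φ t p O fv)) (ℓL κ Φ t p O.merged (gOf κ Φ t p O gv) (fOf κ Φ t p O fv)) (vL κ Φ t p O.merged (gOf κ Φ t p O gv) (fOf κ Φ t p O fv))) yL) +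
      (20 * (((fcells κ Φ t p O.merged (gOf κ Φ t p O gv) (fOf κ Φ t p O fv))).K : ℤ) * (((fcells κ Φ t p O.merged (gOf κ Φ t p O gv) (fOf κ Φ t p O fv))).s 0 : ℤ) * (800 * (TwoAxis.Para.modulus (nL κ Φ t p O.merged (gOf κ Φ t p O gv) (fOf κ Φ t p O fv)) (hL κ Φ t p O.merged (gOf κ Φ t p O gv) (fOf κ Φ t p O fv)) (vL κ Φ t p O.merged (gOf κ Φ t p O gv) (fOf κ Φ t p O fv)) (Skelφ.NegPrm.vβOf (nL κ Φ t p O.merged (gOf κ Φ t p O gv) (fOf κ Φ t p O fv)) (hL κ Φ t p O.merged (gOf κ Φ t p O gv) (fOf κ Φ t p O fv)) (ℓL κ Φ t p O.merged (gOf κ Φ t p O gv) (fOf κ Φ t p O fv)) (vL κ Φ t p O.merged (gOf κ Φ t p O gv) (fOf κ Φ t p O fv))) * (max (sgOf du * paLo) (sgOf du * paHi)) -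
        min ((vL κ Φ t p O.merged (gOf κ Φ t p O gv) (fOf κ Φ t p O fv)) * ((shearUnit (nL κ Φ t p O.merged (gOf κ Φ t p O gv) (fOf κ Φ t p O fv)) (hL κ Φ t p O.merged (gOf κ Φ t p O gv) (fOf κ Φ t p O fv)) : ℤ) * (min (sgOf du * pbLo) (sgOf du * pbHi) - 1))) ((vL κ Φ t p O.merged (gOf κ Φ t p O gv) (fOf κ Φ t p O fv)) * ((shearUnit (nL κ Φ t p O.merged (gOf κ Φ t p O gv) (fOf κ Φ t p O fv)) (hL κ Φ t p O.merged (gOf κ Φ t p O gv) (fOf κ Φ t p O fv)) : ℤ) * (max (sgOf du * pbLo) (sgOf du * pbHi)) + shearUnit (nL κ Φ t p O.merged (gOf κ Φ t p O gv) (fOf κ Φ t p O fv)) (hL κ Φ t p O.merged (gOf κ Φ t p O gv) (fOf κ Φ t p O fv)) - 1))) / (nL κ Φ t p O.merged (gOf κ Φ t p O gv) (fOf κ Φ t p O fv)))) / (Skelφ.NegPrm.Dof (nL κ Φ t p O.merged (gOf κ Φ t p O gv) (fOf κ Φ t p O fv)) (hL κ Φ t p O.merged (gOf κ Φ t p O gv)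 (fOf κ Φ t p O fv)) (ℓL κ Φ t p O.merged (gOf κ Φ t p O gv) (fOf κ Φ t p O fv)) (vL κ Φ t p O.merged (gOf κ Φ t p O gv) (fOf κ Φ t p O fv)))
        + 1 ≤ PHI 0)
    (hP2 : PLO 1 ≤ TwoAxis.Para.coarse (20 * (((fcells κ Φ t p O.merged (gOf κ Φ t p O gv) (fOf κ Φ t p O fv))).K : ℤ) * (((fcells κ Φ t p O.merged (gOf κ Φ t p O gv) (fOf κ Φ t p O fv))).s 1 : ℤ)) ((Skelφ.NegPrm.Dof (nL κ Φ t p O.merged (gOf κ Φ t p O gv) (fOf κ Φ t p O fv)) (hL κ Φ t p O.merged (gOf κ Φ t p O gv) (fOf κ Φ t p O fv)) (ℓL κ Φ t p O.merged (gOf κ Φ t p O gv) (fOf κ Φ t p O fv)) (vL κ Φ t p O.merged (gOf κ Φ t p O gv) (fOf κ Φ t p O fv))) / 2) (Skelφ.NegPrm.Dof (nL κ Φ t p O.merged (gOf κ Φ t p O gv) (fOf κ Φ t p O fv)) (hL κ Φ t p O.merged (gOf κ Φ t p O gv) (fOf κ Φ t p O fv)) (ℓL κ Φ t p O.merged (gOf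 κ Φ t p O gv) (fOf κ Φ t p O fv)) (vL κ Φ t p O.merged (gOf κ Φ t p O gv) (fOf κ Φ t p O fv))) (TwoAxis.Para.lam1 800 (nL κ Φ t p O.merged (gOf κ Φ t p O gv) (fOf κ Φ t p O fv)) (hL κ Φ t p O.merged (gOf κ Φ t p O gv) (fOf κ Φ t p O fv)) yL) +
      (20 * (((fcells κ Φ t p O.merged (gOf κ Φ t p O gv) (fOf κ Φ t p O fv))).K : ℤ) * (((fcells κ Φ t p O.merged (gOf κ Φ t p O gv) (fOf κ Φ t p O fv))).s 1 : ℤ) * (800 * ((shearUnit (nL κ Φ t p O.merged (gOf κ Φ t p O gv) (fOf κ Φ t p O fv)) (hL κ Φ t p O.merged (gOf κ Φ t p O gv) (fOf κ Φ t p O fv)) : ℤ) * (min (sgOf du * pbLo) (sgOf du * pbHi) - 1)))) / (Skelφ.NegPrm.Dof (nL κ Φ t p O.merged (gOf κ Φ t p O gv) (fOf κ Φ t p O fv)) (hL κ Φ t p O.merged (gOf κ Φ t p O gv) (fOf κ Φ t p O fv)) (ℓL κ Φ t p O.merged (gOf κ Φ t p O gv) (fOf κ Φ t p O fv)) (vL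 κ Φ t p O.merged (gOf κ Φ t p O gv) (fOf κ Φ t p O fv))))
    (hP3 : TwoAxis.Para.coarse (20 * (((fcells κ Φ t p O.merged (gOf κ Φ t p O gv) (fOf κ Φ t p O fv))).K : ℤ) * (((fcells κ Φ t p O.merged (gOf κ Φ t p O gv) (fOf κ Φ t p O fv))).s 1 : ℤ)) ((Skelφ.NegPrm.Dof (nL κ Φ t p O.merged (gOf κ Φ t p O gv) (fOf κ Φ t p O fv)) (hL κ Φ t p O.merged (gOf κ Φ t p O gv) (fOf κ Φ t p O fv)) (ℓL κ Φ t p O.merged (gOf κ Φ t p O gv) (fOf κ Φ t p O fv)) (vL κ Φ t p O.merged (gOf κ Φ t p O gv) (fOf κ Φ t p O fv))) / 2) (Skelφ.NegPrm.Dof (nL κ Φ t p O.merged (gOf κ Φ t p O gv) (fOf κ Φ t p O fv)) (hL κ Φ t p O.merged (gOf κ Φ t p O gv) (fOf κ Φ t p O fv)) (ℓL κ Φ t p O.merged (gOf κ Φ t p O gv) (fOf κ Φ t p O fv)) (vL κ Φ t p O.merged (gOf κ Φ t p O gv) (fOf κ Φ t p O fv))) (TwoAxis.Para.lam1 800 (nL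 κ Φ t p O.merged (gOf κ Φ t p O gv) (fOf κ Φ t p O fv)) (hL κ Φ t p O.merged (gOf κ Φ t p O gv) (fOf κ Φ t p O fv)) yL) +
      (20 * (((fcells κ Φ t p O.merged (gOf κ Φ t p O gv) (fOf κ Φ t p O fv))).K : ℤ) * (((fcells κ Φ t p O.merged (gOf κ Φ t p O gv) (fOf κ Φ t p O fv))).s 1 : ℤ) * (800 * ((shearUnit (nL κ Φ t p O.merged (gOf κ Φ t p O gv) (fOf κ Φ t p O fv)) (hL κ Φ t p O.merged (gOf κ Φ t p O gv) (fOf κ Φ t p O fv)) : ℤ) * (max (sgOf du * pbLo) (sgOf du * pbHi)) + shearUnit (nL κ Φ t p O.merged (gOf κ Φ t p O gv) (fOf κ Φ t p O fv)) (hL κ Φ t p O.merged (gOf κ Φ t p O gv) (fOf κ Φ t p O fv)) - 1))) / (Skelφ.NegPrm.Dof (nL κ Φ t p O.merged (gOf κ Φ t p O gv) (fOf κ Φ t p O fv)) (hL κ Φ t p O.merged (gOf κ Φ t p O gv) (fOf κ Φ t p O fv)) (ℓL κ Φ t p O.merged (gOf κ Φ t p O gv) (fOf κ Φ t p O fv))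 (vL κ Φ t p O.merged (gOf κ Φ t p O gv) (fOf κ Φ t p O fv))) + 1 ≤ PHI 1)
    (hPf₁ : sgOf du = 1 → -(5 * (((fcells κ Φ t p O.merged (gOf κ Φ t p O gv) (fOf κ Φ t p O fv))).r du.1 : ℤ)) + 1 ≤ PLO du.1 ∧ PHI du.1 ≤ 25 * (((fcells κ Φ t p O.merged (gOf κ Φ t p O gv) (fOf κ Φ t p O fv))).r du.1 : ℤ) - 1)
    (hPf₂ : sgOf du = -1 → -(5 * (((fcells κ Φ t p O.merged (gOf κ Φ t p O gv) (fOf κ Φ t p O fv))).r du.1 : ℤ)) + 1 ≤ -PHI du.1 ∧ -PLO du.1 ≤ 25 * (((fcells κ Φ t p O.merged (gOf κ Φ t p O gv) (fOf κ Φ t p O fv))).r du.1 : ℤ) - 1)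
    (hPf₃ : -(5 * (((fcells κ Φ t p O.merged (gOf κ Φ t p O gv) (fOf κ Φ t p O fv))).r (oth du.1) : ℤ) - 2) ≤ PLO (oth du.1) ∧ PHI (oth du.1) ≤ 5 * (((fcells κ Φ t p O.merged (gOf κ Φ t p O gv) (fOf κ Φ t p O fv))).r (oth du.1) : ℤ) - 2)
    (hL0 : LLO 0 ≤ TwoAxis.Para.coarse (20 * (((fcells κ Φ t p O.merged (gOf κ Φ t p O gv) (fOf κ Φ t p O fv))).K : ℤ) * (((fcells κ Φ t p O.merged (gOf κ Φ t p O gv) (fOf κ Φ t p O fv))).s 0 : ℤ)) ((Skelφ.NegPrm.Dof (nL κ Φ t p O.merged (gOf κ Φ t p O gv) (fOf κ Φ t p O fv)) (hL κ Φ t p O.merged (gOf κ Φ t p O gv) (fOf κ Φ t p O fv)) (ℓL κ Φ t p O.merged (gOf κ Φ t p O gv) (fOf κ Φ t p O fv)) (vL κ Φ t p O.merged (gOf κ Φ t p O gv) (fOf κ Φ t p O fv))) / 2) (Skelφ.NegPrm.Dof (nL κ Φ t p O.merged (gOf κ Φ t p O gv) (fOf κ Φ t p O fv)) (hL κ Φ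 t p O.merged (gOf κ Φ t p O gv) (fOf κ Φ t p O fv)) (ℓL κ Φ t p O.merged (gOf κ Φ t p O gv) (fOf κ Φ t p O fv)) (vL κ Φ t p O.merged (gOf κ Φ t p O gv) (fOf κ Φ t p O fv))) (TwoAxis.Para.lam0 800 (vL κ Φ t p O.merged (gOf κ Φ t p O gv) (fOf κ Φ t p O fv)) (Skelφ.NegPrm.vβOf (nL κ Φ t p O.merged (gOf κ Φ t p O gv) (fOf κ Φ t p O fv)) (hL κ Φ t p O.merged (gOf κ Φ t p O gv) (fOf κ Φ t p O fv)) (ℓL κ Φ t p O.merged (gOf κ Φ t p O gv) (fOf κ Φ t p O fv)) (vL κ Φ t p O.merged (gOf κ Φ t p O gv) (fOf κ Φ t p O fv))) yL) +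
      (20 * (((fcells κ Φ t p O.merged (gOf κ Φ t p O gv) (fOf κ Φ t p O fv))).K : ℤ) * (((fcells κ Φ t p O.merged (gOf κ Φ t p O gv) (fOf κ Φ t p O fv))).s 0 : ℤ) * (800 * (TwoAxis.Para.modulus (nL κ Φ t p O.merged (gOf κ Φ t p O gv) (fOf κ Φ t p O fv)) (hL κ Φ t p O.merged (gOf κ Φ t p O gv) (fOf κ Φ t p O fv)) (vL κ Φ t p O.merged (gOf κ Φ t p O gv) (fOf κ Φ t p O fv)) (Skelφ.NegPrm.vβOf (nL κ Φ t p O.merged (gOf κ Φ t p O gv) (fOf κ Φ t p O fv)) (hL κ Φ t p O.merged (gOf κ Φ t p O gv) (fOf κ Φ t p O fv)) (ℓL κ Φ t p O.merged (gOf κ Φ t p O gv) (fOf κ Φ t p O fv)) (vL κ Φ t p O.merged (gOf κ Φ t p O gv) (fOf κ Φ t p O fv))) * (min (sgOf du * laLo) (sgOf du * laHi)) -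
        max ((vL κ Φ t p O.merged (gOf κ Φ t p O gv) (fOf κ Φ t p O fv)) * ((shearUnit (nL κ Φ t p O.merged (gOf κ Φ t p O gv) (fOf κ Φ t p O fv)) (hL κ Φ t p O.merged (gOf κ Φ t p O gv) (fOf κ Φ t p O fv)) : ℤ) * (min (sgOf du * lbLo) (sgOf du * lbHi) - 1))) ((vL κ Φ t p O.merged (gOf κ Φ t p O gv) (fOf κ Φ t p O fv)) * ((shearUnit (nL κ Φ t p O.merged (gOf κ Φ t p O gv) (fOf κ Φ t p O fv)) (hL κ Φ t p O.merged (gOf κ Φ t p O gv) (fOf κ Φ t p O fv)) : ℤ) * (max (sgOf du * lbLo) (sgOf du * lbHi)) + shearUnit (nL κ Φ t p O.merged (gOf κ Φ t p O gv) (fOf κ Φ t p O fv)) (hL κ Φ t p O.merged (gOf κ Φ t p O gv) (fOf κ Φ t p O fv)) - 1))) / (nL κ Φ t p O.merged (gOf κ Φ t p O gv) (fOf κ Φ t p O fv)))) / (Skelφ.NegPrm.Dof (nL κ Φ t p O.merged (gOf κ Φ t p O gv) (fOf κ Φ t p O fv)) (hL κ Φ t p O.merged (gOf κ Φ t p O gv)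 (fOf κ Φ t p O fv)) (ℓL κ Φ t p O.merged (gOf κ Φ t p O gv) (fOf κ Φ t p O fv)) (vL κ Φ t p O.merged (gOf κ Φ t p O gv) (fOf κ Φ t p O fv))))
    (hL1 : TwoAxis.Para.coarse (20 * (((fcells κ Φ t p O.merged (gOf κ Φ t p O gv) (fOf κ Φ t p O fv))).K : ℤ) * (((fcells κ Φ t p O.merged (gOf κ Φ t p O gv) (fOf κ Φ t p O fv))).s 0 : ℤ)) ((Skelφ.NegPrm.Dof (nL κ Φ t p O.merged (gOf κ Φ t p O gv) (fOf κ Φ t p O fv)) (hL κ Φ t p O.merged (gOf κ Φ t p O gv) (fOf κ Φ t p O fv)) (ℓL κ Φ t p O.merged (gOf κ Φ t p O gv) (fOf κ Φ t p O fv)) (vL κ Φ t p O.merged (gOf κ Φ t p O gv) (fOf κ Φ t p O fv))) / 2) (Skelφ.NegPrm.Dof (nL κ Φ t p O.merged (gOf κ Φ t p O gv) (fOf κ Φ t p O fv)) (hL κ Φ t p O.merged (gOf κ Φ t p O gv) (fOf κ Φ t p O fv)) (ℓL κ Φ t p O.merged (gOf κ Φ t p O gv) (fOf κ Φ t p O fv))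 (vL κ Φ t p O.merged (gOf κ Φ t p O gv) (fOf κ Φ t p O fv))) (TwoAxis.Para.lam0 800 (vL κ Φ t p O.merged (gOf κ Φ t p O gv) (fOf κ Φ t p O fv)) (Skelφ.NegPrm.vβOf (nL κ Φ t p O.merged (gOf κ Φ t p O gv) (fOf κ Φ t p O fv)) (hL κ Φ t p O.merged (gOf κ Φ t p O gv) (fOf κ Φ t p O fv)) (ℓL κ Φ t p O.merged (gOf κ Φ t p O gv) (fOf κ Φ t p O fv)) (vL κ Φ t p O.merged (gOf κ Φ t p O gv) (fOf κ Φ t p O fv))) yL) +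
      (20 * (((fcells κ Φ t p O.merged (gOf κ Φ t p O gv) (fOf κ Φ t p O fv))).K : ℤ) * (((fcells κ Φ t p O.merged (gOf κ Φ t p O gv) (fOf κ Φ t p O fv))).s 0 : ℤ) * (800 * (TwoAxis.Para.modulus (nL κ Φ t p O.merged (gOf κ Φ t p O gv) (fOf κ Φ t p O fv)) (hL κ Φ t p O.merged (gOf κ Φ t p O gv) (fOf κ Φ t p O fv)) (vL κ Φ t p O.merged (gOf κ Φ t p O gv) (fOf κ Φ t p O fv)) (Skelφ.NegPrm.vβOf (nL κ Φ t p O.merged (gOf κ Φ t p O gv) (fOf κ Φ t p O fv)) (hL κ Φ t p O.merged (gOf κ Φ t p O gv) (fOf κ Φ t p O fv)) (ℓL κ Φ t p O.merged (gOf κ Φ t p O gv) (fOf κ Φ t p O fv)) (vL κ Φ t p O.merged (gOf κ Φ t p O gv) (fOf κ Φ t p O fv))) * (max (sgOf du * laLo) (sgOf du * laHi)) -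
        min ((vL κ Φ t p O.merged (gOf κ Φ t p O gv) (fOf κ Φ t p O fv)) * ((shearUnit (nL κ Φ t p O.merged (gOf κ Φ t p O gv) (fOf κ Φ t p O fv)) (hL κ Φ t p O.merged (gOf κ Φ t p O gv) (fOf κ Φ t p O fv)) : ℤ) * (min (sgOf du * lbLo) (sgOf du * lbHi) - 1))) ((vL κ Φ t p O.merged (gOf κ Φ t p O gv) (fOf κ Φ t p O fv)) * ((shearUnit (nL κ Φ t p O.merged (gOf κ Φ t p O gv) (fOf κ Φ t p O fv)) (hL κ Φ t p O.merged (gOf κ Φ t p O gv) (fOf κ Φ t p O fv)) : ℤ) * (max (sgOf du * lbLo) (sgOf du * lbHi)) + shearUnit (nL κ Φ t p O.merged (gOf κ Φ t p O gv) (fOf κ Φ t p O fv)) (hL κ Φ t p O.merged (gOf κ Φ t p O gv) (fOf κ Φ t p O fv)) - 1))) / (nL κ Φ t p O.merged (gOf κ Φ t p O gv) (fOf κ Φ t p O fv)))) / (Skelφ.NegPrm.Dof (nL κ Φ t p O.merged (gOf κ Φ t p O gv) (fOf κ Φ t p O fv)) (hL κ Φ t p O.merged (gOf κ Φ t p O gv)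 (fOf κ Φ t p O fv)) (ℓL κ Φ t p O.merged (gOf κ Φ t p O gv) (fOf κ Φ t p O fv)) (vL κ Φ t p O.merged (gOf κ Φ t p O gv) (fOf κ Φ t p O fv)))
        + 1 ≤ LHI 0)
    (hL2 : LLO 1 ≤ TwoAxis.Para.coarse (20 * (((fcells κ Φ t p O.merged (gOf κ Φ t p O gv) (fOf κ Φ t p O fv))).K : ℤ) * (((fcells κ Φ t p O.merged (gOf κ Φ t p O gv) (fOf κ Φ t p O fv))).s 1 : ℤ)) ((Skelφ.NegPrm.Dof (nL κ Φ t p O.merged (gOf κ Φ t p O gv) (fOf κ Φ t p O fv)) (hL κ Φ t p O.merged (gOf κ Φ t p O gv) (fOf κ Φ t p O fv)) (ℓL κ Φ t p O.merged (gOf κ Φ t p O gv) (fOf κ Φ t p O fv)) (vL κ Φ t p O.merged (gOf κ Φ t p O gv) (fOf κ Φ t p O fv))) / 2) (Skelφ.NegPrm.Dof (nL κ Φ t p O.merged (gOf κ Φ t p O gv) (fOf κ Φ t p O fv)) (hL κ Φ t p O.merged (gOf κ Φ t p O gv) (fOf κ Φ t p O fv)) (ℓL κ Φ t p O.merged (gOf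 κ Φ t p O gv) (fOf κ Φ t p O fv)) (vL κ Φ t p O.merged (gOf κ Φ t p O gv) (fOf κ Φ t p O fv))) (TwoAxis.Para.lam1 800 (nL κ Φ t p O.merged (gOf κ Φ t p O gv) (fOf κ Φ t p O fv)) (hL κ Φ t p O.merged (gOf κ Φ t p O gv) (fOf κ Φ t p O fv)) yL) +
      (20 * (((fcells κ Φ t p O.merged (gOf κ Φ t p O gv) (fOf κ Φ t p O fv))).K : ℤ) * (((fcells κ Φ t p O.merged (gOf κ Φ t p O gv) (fOf κ Φ t p O fv))).s 1 : ℤ) * (800 * ((shearUnit (nL κ Φ t p O.merged (gOf κ Φ t p O gv) (fOf κ Φ t p O fv)) (hL κ Φ t p O.merged (gOf κ Φ t p O gv) (fOf κ Φ t p O fv)) : ℤ) * (min (sgOf du * lbLo) (sgOf du * lbHi) - 1)))) / (Skelφ.NegPrm.Dof (nL κ Φ t p O.merged (gOf κ Φ t p O gv) (fOf κ Φ t p O fv)) (hL κ Φ t p O.merged (gOf κ Φ t p O gv) (fOf κ Φ t p O fv)) (ℓL κ Φ t p O.merged (gOf κ Φ t p O gv) (fOf κ Φ t p O fv)) (vL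 κ Φ t p O.merged (gOf κ Φ t p O gv) (fOf κ Φ t p O fv))))
    (hL3 : TwoAxis.Para.coarse (20 * (((fcells κ Φ t p O.merged (gOf κ Φ t p O gv) (fOf κ Φ t p O fv))).K : ℤ) * (((fcells κ Φ t p O.merged (gOf κ Φ t p O gv) (fOf κ Φ t p O fv))).s 1 : ℤ)) ((Skelφ.NegPrm.Dof (nL κ Φ t p O.merged (gOf κ Φ t p O gv) (fOf κ Φ t p O fv)) (hL κ Φ t p O.merged (gOf κ Φ t p O gv) (fOf κ Φ t p O fv)) (ℓL κ Φ t p O.merged (gOf κ Φ t p O gv) (fOf κ Φ t p O fv)) (vL κ Φ t p O.merged (gOf κ Φ t p O gv) (fOf κ Φ t p O fv))) / 2) (Skelφ.NegPrm.Dof (nL κ Φ t p O.merged (gOf κ Φ t p O gv) (fOf κ Φ t p O fv)) (hL κ Φ t p O.merged (gOf κ Φ t p O gv) (fOf κ Φ t p O fv)) (ℓL κ Φ t p O.merged (gOf κ Φ t p O gv) (fOf κ Φ t p O fv)) (vL κ Φ t p O.merged (gOf κ Φ t p O gv) (fOf κ Φ t p O fv))) (TwoAxis.Para.lam1 800 (nL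 κ Φ t p O.merged (gOf κ Φ t p O gv) (fOf κ Φ t p O fv)) (hL κ Φ t p O.merged (gOf κ Φ t p O gv) (fOf κ Φ t p O fv)) yL) +
      (20 * (((fcells κ Φ t p O.merged (gOf κ Φ t p O gv) (fOf κ Φ t p O fv))).K : ℤ) * (((fcells κ Φ t p O.merged (gOf κ Φ t p O gv) (fOf κ Φ t p O fv))).s 1 : ℤ) * (800 * ((shearUnit (nL κ Φ t p O.merged (gOf κ Φ t p O gv) (fOf κ Φ t p O fv)) (hL κ Φ t p O.merged (gOf κ Φ t p O gv) (fOf κ Φ t p O fv)) : ℤ) * (max (sgOf du * lbLo) (sgOf du * lbHi)) + shearUnit (nL κ Φ t p O.merged (gOf κ Φ t p O gv) (fOf κ Φ t p O fv)) (hL κ Φ t p O.merged (gOf κ Φ t p O gv) (fOf κ Φ t p O fv)) - 1))) / (Skelφ.NegPrm.Dof (nL κ Φ t p O.merged (gOf κ Φ t p O gv) (fOf κ Φ t p O fv)) (hL κ Φ t p O.merged (gOf κ Φ t p O gv) (fOf κ Φ t p O fv)) (ℓL κ Φ t p O.merged (gOf κ Φ t p O gv) (fOf κ Φ t p O fv))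 (vL κ Φ t p O.merged (gOf κ Φ t p O gv) (fOf κ Φ t p O fv))) + 1 ≤ LHI 1)
    (hLg₁ : sgOf du = 1 → 20 * (((fcells κ Φ t p O.merged (gOf κ Φ t p O gv) (fOf κ Φ t p O fv))).r du.1 : ℤ) - (b0T κ Φ t p O.merged (gOf κ Φ t p O gv) (fOf κ Φ t p O fv) du.1 : ℤ) + 1 ≤ LLO du.1 ∧
      LHI du.1 ≤ 20 * (((fcells κ Φ t p O.merged (gOf κ Φ t p O gv) (fOf κ Φ t p O fv))).r du.1 : ℤ) + (b0T κ Φ t p O.merged (gOf κ Φ t p O gv) (fOf κ Φ t p O fv) du.1 : ℤ) - 1)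
    (hLg₂ : sgOf du = -1 → 20 * (((fcells κ Φ t p O.merged (gOf κ Φ t p O gv) (fOf κ Φ t p O fv))).r du.1 : ℤ) - (b0T κ Φ t p O.merged (gOf κ Φ t p O gv) (fOf κ Φ t p O fv) du.1 : ℤ) + 1 ≤ -LHI du.1 ∧
      -LLO du.1 ≤ 20 * (((fcells κ Φ t p O.merged (gOf κ Φ t p O gv) (fOf κ Φ t p O fv))).r du.1 : ℤ) + (b0T κ Φ t p O.merged (gOf κ Φ t p O gv) (fOf κ Φ t p O fv) du.1 : ℤ) - 1)
    (hLg₃ : -((b0T κ Φ t p O.merged (gOf κ Φ t p O gv) (fOf κ Φ t p O fv) (oth du.1) : ℤ) - 1) ≤ LLO (oth du.1) ∧ LHI (oth du.1) ≤ (b0T κ Φ t p O.merged (gOf κ Φ t p O gv) (fOf κ Φ t p O fv) (oth du.1) : ℤ) - 1)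
    -- ROOM NUMBERS (d): the cross link, the clearances, the reaches inside the window; late thresholds inside the window; excess radii
    (hxa : ∀ x ∈ Finset.Icc B.core1Lo B.core1Hi, |x 0 - sgOf du * yL 0| ≤ qB)
    (hxb : ∀ x ∈ Finset.Icc B.core1Lo B.core1Hi,
      |sgOf du * (((nL κ Φ t p O.merged (gOf κ Φ t p O gv) (fOf κ Φ t p O fv)) : ℤ) * (x 1 - yL 1) - (hL κ Φ t p O.merged (gOf κ Φ t p O gv) (fOf κ Φ t p O fv)) * (sgOf du * x 0 - yL 0))| + shearUnit (nL κ Φ t p O.merged (gOf κ Φ t p O gv) (fOf κ Φ t p O fv)) (hL κ Φ t p O.merged (gOf κ Φ t p O gv) (fOf κ Φ t p O fv)) ≤ (((nL κ Φ t p O.merged (gOf κ Φ t p O gv) (fOf κ Φ t p O fv)) * (ℓL κ Φ t p O.merged (gOf κ Φ t p O gv) (fOf κ Φ t p O fv)) / shearUnit (nL κ Φ t p O.merged (gOf κ Φ t p O gv) (fOf κ Φ t p O fv)) (hL κ Φ t p O.merged (gOf κ Φ t p O gv) (fOf κ Φ t p O fv)) + 1 : ℕ) : ℤ) * shearUnit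 (nL κ Φ t p O.merged (gOf κ Φ t p O gv) (fOf κ Φ t p O fv)) (hL κ Φ t p O.merged (gOf κ Φ t p O gv) (fOf κ Φ t p O fv)))
    (hclr : (O.merged.k : ℤ) < sgOf du * yL 0 - qB - KS.RA' κ Φ t p O.merged mk - (((nL κ Φ t p O.merged (gOf κ Φ t p O gv) (fOf κ Φ t p O fv)) : ℕ) : ℤ)) (hRn : KS.RA' κ Φ t p O.merged mk ≤ (nL κ Φ t p O.merged (gOf κ Φ t p O gv) (fOf κ Φ t p O fv)))
    (hclr₁ : (O.merged.k : ℤ) < B.B₀lo 0 - B.R' - B.pr)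
    (hπ1 : (B.core1Lo 0).natAbs + (B.core1Lo 1).natAbs ≤ Rπ) (hπ2 : (yL 0).natAbs + (yL 1).natAbs + (Nr + 1) * shearUnit (nL κ Φ t p O.merged (gOf κ Φ t p O gv) (fOf κ Φ t p O fv)) (hL κ Φ t p O.merged (gOf κ Φ t p O gv) (fOf κ Φ t p O fv)) ≤ Rπ)
    (hRb₀ : KS.r₀A Φ t O.merged mk Rb ≤ Rπ) (hRr₀ : KS.r₀A Φ t O.merged mk (O.merged.R (O.merged.scale t (ML κ Φ t p O.merged (gOf κ Φ t p O gv)) (nL κ Φ t p O.merged (gOf κ Φ t p O gv) (fOf κ Φ t p O fv)))) ≤ Rπ) (hRbπ : Rb ≤ Rπ)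
    (hR₁b : Rex κ Φ (mR κ Φ t p O.merged (gOf κ Φ t p O gv) (fOf κ Φ t p O fv) mx) q (Skelφ.fatRadius Φ.frame hC O.merged.k) ≤ Rπ - KS.r₀A Φ t O.merged mk Rb)
    (hR₁r : Rex κ Φ (mR κ Φ t p O.merged (gOf κ Φ t p O gv) (fOf κ Φ t p O fv) mx) q (Skelφ.fatRadius Φ.frame hC O.merged.k) ≤ Rπ - KS.r₀A Φ t O.merged mk (O.merged.R (O.merged.scale t (ML κ Φ t p O.merged (gOf κ Φ t p O gv)) (nL κ Φ t p O.merged (gOf κ Φ t p O gv) (fOf κ Φ t p O fv))))) :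
    Skel.RootOblTWAt G ((choiceAtOT κ Φ t p gv fv Sv hC Pv).scheme O q) Φ.Δ κ.δr du := by
  have hAtS := atQOS_of_atQOT hAt
  obtain ⟨hF, hq1, hq2, hCq⟩ := factsO_of_atQOS hAtS
  have hAtB := atQOB_of_atQOS hAtS
  obtain ⟨hm₀k, hk1, hkM₀, hReq, hΛeq⟩ := hF.seed
  have hσ : sgOf du = 1 ∨ sgOf du = -1 := sgOf_sign du
  have hEqL := clauseL_of_atQOS hAtS
  have hNL : EqNumL κ Φ t p O.merged (gOf κ Φ t p O gv) (fOf κ Φ t p O fv) := eqNumL_of_atQOS hAtS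
  obtain ⟨hnL, hℓL⟩ := one_le_of_eqNumL κ Φ t p O.merged (gOf κ Φ t p O gv) (fOf κ Φ t p O fv) hNL
  have hκL : ((hL κ Φ t p O.merged (gOf κ Φ t p O gv) (fOf κ Φ t p O fv))).natAbs ≤ 10 * (nL κ Φ t p O.merged (gOf κ Φ t p O gv) (fOf κ Φ t p O fv)) := hEqL.2
  have hκL10 : |(hL κ Φ t p O.merged (gOf κ Φ t p O gv) (fOf κ Φ t p O fv))| ≤ 10 * (((nL κ Φ t p O.merged (gOf κ Φ t p O gv) (fOf κ Φ t p O fv)) : ℕ) : ℤ) := by rw [← Int.natCast_natAbs]; exact_mod_cast hκL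
  have hlip : Skelφ.Lip G (φL κ Φ t p O.D O.DT O.ori (gOf κ Φ t p O gv) (fOf κ Φ t p O fv)) := lip_φL κ Φ t p O.D O.DT O.ori (gOf κ Φ t p O gv) (fOf κ Φ t p O fv)
  have hstep : Skelφ.Steps G (φL κ Φ t p O.D O.DT O.ori (gOf κ Φ t p O gv) (fOf κ Φ t p O fv)) := steps_φL κ Φ t p O.D O.DT O.ori (gOf κ Φ t p O gv) (fOf κ Φ t p O fv)
  have hfr : Skelφ.Frames G (φL κ Φ t p O.D O.DT O.ori (gOf κ Φ t p O gv) (fOf κ Φ t p O fv)) Φ.types := Skelφ.frames_oriφ Φ.frame _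
  have hκc : Skelφ.CylConn G (φL κ Φ t p O.D O.DT O.ori (gOf κ Φ t p O gv) (fOf κ Φ t p O fv)) Φ.types := Skelφ.cylConn_oriφ Φ.cyl_connected _
  have hAf : (0 : ℤ) ≤ 800 := by norm_num
  have hmf : 0 ≤ TwoAxis.Para.modulus (nL κ Φ t p O.merged (gOf κ Φ t p O gv) (fOf κ Φ t p O fv)) (hL κ Φ t p O.merged (gOf κ Φ t p O gv) (fOf κ Φ t p O fv)) (vL κ Φ t p O.merged (gOf κ Φ t p O gv) (fOf κ Φ t p O fv)) (Skelφ.NegPrm.vβOf (nL κ Φ t p O.merged (gOf κ Φ t p O gv) (fOf κ Φ t p O fv)) (hL κ Φ t p O.merged (gOf κ Φ t p O gv) (fOf κ Φ t p O fv)) (ℓL κ Φ t p O.merged (gOf κ Φ t p O gv) (fOf κ Φ t p O fv)) (vL κ Φ t p O.merged (gOf κ Φ t p O gv) (fOf κ Φ t p O fv))) := (Skelφ.NegPrm.modulus_vβOf_pos hnL hℓL _ _).le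
  have hc0 := Skelφ.NegPrm.c_nonneg ((fcells κ Φ t p O.merged (gOf κ Φ t p O gv) (fOf κ Φ t p O fv))) 0
  have hc1 := Skelφ.NegPrm.c_nonneg ((fcells κ Φ t p O.merged (gOf κ Φ t p O gv) (fOf κ Φ t p O fv))) 1
  have hDf : 0 < (Skelφ.NegPrm.Dof (nL κ Φ t p O.merged (gOf κ Φ t p O gv) (fOf κ Φ t p O fv)) (hL κ Φ t p O.merged (gOf κ Φ t p O gv) (fOf κ Φ t p O fv)) (ℓL κ Φ t p O.merged (gOf κ Φ t p O gv) (fOf κ Φ t p O fv)) (vL κ Φ t p O.merged (gOf κ Φ t p O gv) (fOf κ Φ t p O fv))) := Skelφ.NegPrm.Dof_pos hnL hℓL _ _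
  let FS := Skelφ.fineSkel (φL κ Φ t p O.D O.DT O.ori (gOf κ Φ t p O gv) (fOf κ Φ t p O fv)) t 800 (nL κ Φ t p O.merged (gOf κ Φ t p O gv) (fOf κ Φ t p O fv)) (hL κ Φ t p O.merged (gOf κ Φ t p O gv) (fOf κ Φ t p O fv)) (vL κ Φ t p O.merged (gOf κ Φ t p O gv) (fOf κ Φ t p O fv)) (Skelφ.NegPrm.vβOf (nL κ Φ t p O.merged (gOf κ Φ t p O gv) (fOf κ Φ t p O fv)) (hL κ Φ t p O.merged (gOf κ Φ t p O gv) (fOf κ Φ t p O fv)) (ℓL κ Φ t p O.merged (gOf κ Φ t p O gv) (fOf κ Φ t p O fv)) (vL κ Φ t p O.merged (gOf κ Φ t p O gv) (fOf κ Φ t p O fv))) (20 * (((fcells κ Φ t p O.merged (gOf κ Φ t p O gv) (fOf κ Φ t p O fv))).K : ℤ) * (((fcells κ Φ t p O.merged (gOf κ Φ t p O gv) (fOf κ Φ t p O fv))).s 0 : ℤ)) (20 * (((fcells κ Φ t p O.merged (gOf κ Φ t p O gv) (fOf κ Φ t p O fv))).K : ℤ) * (((fcells κ Φ t p O.merged (gOf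 κ Φ t p O gv) (fOf κ Φ t p O fv))).s 1 : ℤ)) ((Skelφ.NegPrm.Dof (nL κ Φ t p O.merged (gOf κ Φ t p O gv) (fOf κ Φ t p O fv)) (hL κ Φ t p O.merged (gOf κ Φ t p O gv) (fOf κ Φ t p O fv)) (ℓL κ Φ t p O.merged (gOf κ Φ t p O gv) (fOf κ Φ t p O fv)) (vL κ Φ t p O.merged (gOf κ Φ t p O gv) (fOf κ Φ t p O fv))) / 2) ((Skelφ.NegPrm.Dof (nL κ Φ t p O.merged (gOf κ Φ t p O gv) (fOf κ Φ t p O fv)) (hL κ Φ t p O.merged (gOf κ Φ t p O gv) (fOf κ Φ t p O fv)) (ℓL κ Φ t p O.merged (gOf κ Φ t p O gv) (fOf κ Φ t p O fv)) (vL κ Φ t p O.merged (gOf κ Φ t p O gv) (fOf κ Φ t p O fv))) / 2) (Skelφ.NegPrm.Dof (nL κ Φ t p O.merged (gOf κ Φ t p O gv) (fOf κ Φ t p O fv)) (hL κ Φ t p O.merged (gOf κ Φ t p O gv) (fOf κ Φ t p O fv)) (ℓL κ Φ t p O.merged (gOf κ Φ t p O gv) (fOf κ Φ t p O fv)) (vL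 κ Φ t p O.merged (gOf κ Φ t p O gv) (fOf κ Φ t p O fv)))
  have hfine : fineO κ Φ t p O.D O.DT O.ori (gOf κ Φ t p O gv) (fOf κ Φ t p O fv) = FS := rfl
  have hlipF : Skelφ.Lip G (fineO κ Φ t p O.D O.DT O.ori (gOf κ Φ t p O gv) (fOf κ Φ t p O fv)) := lip_fine_at κ Φ t p O.merged (gOf κ Φ t p O gv) (fOf κ Φ t p O fv) hlip hNL
  have hwsF : Skelφ.WeakSteps G (fineO κ Φ t p O.D O.DT O.ori (gOf κ Φ t p O gv) (fOf κ Φ t p O fv)) := weakSteps_fine_at κ Φ t p O.merged (gOf κ Φ t p O gv) (fOf κ Φ t p O fv) hstep hNL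
  let S : KSchA V ℕ := (choiceAtOT κ Φ t p gv fv Sv hC Pv).scheme O q
  have hroot : S.Γ.root = t := rfl
  let Λs := schedOf κ Φ t p O.merged (gOf κ Φ t p O gv) (fOf κ Φ t p O fv) (Sv κ Φ t p O.merged (gOf κ Φ t p O gv) (fOf κ Φ t p O fv) q)
  have hUfoot : ∀ w ∈ graphBall G t Rπ, FootBox (-(5 * (((fcells κ Φ t p O.merged (gOf κ Φ t p O gv) (fOf κ Φ t p O fv))).r du.1 : ℤ)) + 1) (25 * (((fcells κ Φ t p O.merged (gOf κ Φ t p O gv) (fOf κ Φ t p O fv))).r du.1 : ℤ) - 1) (5 * (((fcells κ Φ t p O.merged (gOf κ Φ t p O gv) (fOf κ Φ t p O fv))).r (oth du.1) : ℤ) - 2) du (FS w) →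
      w ∈ S.U0root du := by
    intro w hw hfb
    rw [← hfine] at hfb
    exact Skelφ.mem_U0rootb_of_footprint ((fcells κ Φ t p O.merged (gOf κ Φ t p O gv) (fOf κ Φ t p O fv))) t Λs du (b0T κ Φ t p O.merged (gOf κ Φ t p O gv) (fOf κ Φ t p O fv)) q κ.δ hlipF hwsF hRQ hRB hRQ' hw hfb.1 hfb.2.1 hfb.2.2
  have hMfoot : ∀ w ∈ graphBall G t Rπ, FootBox (20 * (((fcells κ Φ t p O.merged (gOf κ Φ t p O gv) (fOf κ Φ t p O fv))).r du.1 : ℤ) - (b0T κ Φ t p O.merged (gOf κ Φ t p O gv) (fOf κ Φ t p O fv) du.1 : ℤ) + 1)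
      (20 * (((fcells κ Φ t p O.merged (gOf κ Φ t p O gv) (fOf κ Φ t p O fv))).r du.1 : ℤ) + (b0T κ Φ t p O.merged (gOf κ Φ t p O gv) (fOf κ Φ t p O fv) du.1 : ℤ) - 1) ((b0T κ Φ t p O.merged (gOf κ Φ t p O gv) (fOf κ Φ t p O fv) (oth du.1) : ℤ) - 1) du (FS w) →
      w ∈ S.Γ.M S.Γ.a₀ ((0 : Site 2) + stepVec du) := by
    intro w hw hfb
    rw [← hfine] at hfb
    have ha : |sgOf du * (fineO κ Φ t p O.D O.DT O.ori (gOf κ Φ t p O gv) (fOf κ Φ t p O fv) w) du.1 - 20 * (((fcells κ Φ t p O.merged (gOf κ Φ t p O gv) (fOf κ Φ t p O fv))).r du.1 : ℤ)| ≤ (b0T κ Φ t p O.merged (gOf κ Φ t p O gv) (fOf κ Φ t p O fv) du.1 : ℤ) - 1 :=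
      abs_le.2 ⟨by linarith [hfb.1], by linarith [hfb.2.1]⟩
    exact Skelφ.mem_rootMb_of_footprint ((fcells κ Φ t p O.merged (gOf κ Φ t p O gv) (fOf κ Φ t p O fv))) t Λs du (b0T κ Φ t p O.merged (gOf κ Φ t p O gv) (fOf κ Φ t p O fv)) hlipF hwsF hRM hw ha hfb.2.2
  -- the root world's planar diameter in `φL` (located (L-R1)): fine diameter `≤ 40·rmax ≤ 50·rmax`, converted by `fine_diam_le_mR`
  have hUm : ∀ d ∈ S.U0root du, ∀ d' ∈ S.U0root du, (φL κ Φ t p O.D O.DT O.ori (gOf κ Φ t p O gv) (fOf κ Φ t p O fv)) d - (φL κ Φ t p O.D O.DT O.ori (gOf κ Φ t p O gv) (fOf κ Φ t p O fv)) d' ∈ box 2 (mR κ Φ t p O.merged (gOf κ Φ t p O gv) (fOf κ Φ t p O fv) mx) := by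
    intro d hd d' hd'
    have h := Skelφ.ψ_sub_mem_box_of_mem_U0rootb ((fcells κ Φ t p O.merged (gOf κ Φ t p O gv) (fOf κ Φ t p O fv))) t Λs q κ.δ du (b0T κ Φ t p O.merged (gOf κ Φ t p O gv) (fOf κ Φ t p O fv)) hd hd'
    have h' : fineO κ Φ t p O.D O.DT O.ori (gOf κ Φ t p O gv) (fOf κ Φ t p O fv) d - fineO κ Φ t p O.D O.DT O.ori (gOf κ Φ t p O gv) (fOf κ Φ t p O fv) d' ∈ box 2 (50 * ((fcells κ Φ t p O.merged (gOf κ Φ t p O gv) (fOf κ Φ t p O fv))).rmax) :=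
      box_mono 2 (show 40 * ((fcells κ Φ t p O.merged (gOf κ Φ t p O gv) (fOf κ Φ t p O fv))).rmax ≤ 50 * ((fcells κ Φ t p O.merged (gOf κ Φ t p O gv) (fOf κ Φ t p O fv))).rmax by omega) h
    exact fine_diam_le_mR κ Φ t p O.merged (gOf κ Φ t p O gv) (fOf κ Φ t p O fv) mx hNL h'
  -- ### the pinned seed: the fat seed at level `k`
  let A : Finset V := O.merged.Λ t O.merged.k
  have hAfat : A = Skelφ.fatSeq Φ.frame hC t O.merged.k := by show O.merged.Λ t O.merged.k = _; rw [hΛeq]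
  have htA : t ∈ A := by
    rw [hAfat, Skelφ.mem_fatSeq_iff]; exact Skelφ.self_mem_cylBall G Φ.φ t _ _
  have hAconn : ∀ a ∈ A, PathIn G (↑A : Set V) t a := by
    rw [hAfat, ← Skelφ.fatSeqOff_zero]; exact Skelφ.pathIn_fatSeqOff Φ.frame hC 0 t _
  have hAρ : ∀ a ∈ A, a ∈ graphBall G t (Skelφ.fatRadius Φ.frame hC O.merged.k) := by
    intro a ha
    rw [hAfat, Skelφ.mem_fatSeq_iff] at ha
    exact (Skelφ.cylBall_subset_prism G Φ.φ t _ _ ha).1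
  have hAbox : ∀ a ∈ A, |(φL κ Φ t p O.D O.DT O.ori (gOf κ Φ t p O gv) (fOf κ Φ t p O fv)) a 0 - (φL κ Φ t p O.D O.DT O.ori (gOf κ Φ t p O gv) (fOf κ Φ t p O fv)) t 0| ≤ (O.merged.k : ℤ) ∧ |(φL κ Φ t p O.D O.DT O.ori (gOf κ Φ t p O gv) (fOf κ Φ t p O fv)) a 1 - (φL κ Φ t p O.D O.DT O.ori (gOf κ Φ t p O gv) (fOf κ Φ t p O fv)) t 1| ≤ (O.merged.k : ℤ) := by
    intro a ha
    have hc : a ∈ Skelφ.cyl Φ.φ t O.merged.k := by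
      rw [hAfat] at ha; exact Skelφ.fatSeq_subset_cyl Φ.frame hC t _ (Finset.mem_coe.2 ha)
    have hc' : a ∈ Skelφ.cyl (φL κ Φ t p O.D O.DT O.ori (gOf κ Φ t p O gv) (fOf κ Φ t p O fv)) t O.merged.k := by unfold NegB.φL; rwa [Skelφ.cyl_oriφ]
    rw [Skelφ.mem_cyl, mem_box] at hc'
    have h0 := hc' 0; have h1 := hc' 1
    simp only [Pi.sub_apply] at h0 h1
    exact ⟨abs_le.2 ⟨h0.1, h0.2⟩, abs_le.2 ⟨h1.1, h1.2⟩⟩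
  have hAφ : ∀ a ∈ A, |(φL κ Φ t p O.D O.DT O.ori (gOf κ Φ t p O gv) (fOf κ Φ t p O fv)) a 0 - (φL κ Φ t p O.D O.DT O.ori (gOf κ Φ t p O gv) (fOf κ Φ t p O fv)) t 0| ≤ ((O.merged.k : ℕ) : ℤ) := fun a ha => (hAbox a ha).1
  have hAQ : A ⊆ S.Γ.Q S.Γ.a₀ 0 := by
    intro a ha
    obtain ⟨h0, h1⟩ := hAbox a ha
    obtain ⟨k0, k1⟩ := Skelφ.abs_fineSkel_le_of_near (φ := (φL κ Φ t p O.D O.DT O.ori (gOf κ Φ t p O gv) (fOf κ Φ t p O fv))) t hDf hc0 hc1 hkA0 hkA1 h0 h1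
    have hall : ∀ i : Fin 2, |(FS a) i| ≤ kA := fun i => by
      fin_cases i
      · exact k0
      · exact k1
    have hs : |sgOf du * (FS a) du.1| ≤ kA := by
      rw [abs_mul, show |sgOf du| = 1 by rcases hσ with h | h <;> simp [h], one_mul]; exact hall du.1
    have hs' := abs_le.1 hs
    have h₁ : -(5 * (((fcells κ Φ t p O.merged (gOf κ Φ t p O gv) (fOf κ Φ t p O fv))).r du.1 : ℤ)) + 1 ≤ sgOf du * (fineO κ Φ t p O.D O.DT O.ori (gOf κ Φ t p O gv) (fOf κ Φ t p O fv) a) du.1 := by rw [hfine]; linarith [hs'.1, hkAQ.1]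
    have h₂ : sgOf du * (fineO κ Φ t p O.D O.DT O.ori (gOf κ Φ t p O gv) (fOf κ Φ t p O fv) a) du.1 ≤ 5 * (((fcells κ Φ t p O.merged (gOf κ Φ t p O gv) (fOf κ Φ t p O fv))).r du.1 : ℤ) := by rw [hfine]; linarith [hs'.2, hkAQ.1]
    have h₃ : |(fineO κ Φ t p O.D O.DT O.ori (gOf κ Φ t p O gv) (fOf κ Φ t p O fv) a) (oth du.1)| ≤ 5 * (((fcells κ Φ t p O.merged (gOf κ Φ t p O gv) (fOf κ Φ t p O fv))).r (oth du.1) : ℤ) - 1 := by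
      rw [hfine]; exact (hall (oth du.1)).trans (by linarith [hkAQ.2])
    have hmem := Skelφ.mem_rootQ_of_footprint ((fcells κ Φ t p O.merged (gOf κ Φ t p O gv) (fOf κ Φ t p O fv))) t Λs du hlipF hwsF hRQ (graphBall_mono G t hρπ (hAρ a ha)) h₁ h₂ h₃
    change a ∈ (Skelφ.cellGeomSG₂b G (fineO κ Φ t p O.D O.DT O.ori (gOf κ Φ t p O gv) (fOf κ Φ t p O fv)) ((fcells κ Φ t p O.merged (gOf κ Φ t p O gv) (fOf κ Φ t p O fv))) t Λs (b0T κ Φ t p O.merged (gOf κ Φ t p O gv) (fOf κ Φ t p O fv))).Q 0 0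
    rw [Skelφ.cellGeomSG₂b_Q]; exact hmem
  obtain ⟨cL, hcLπ, hcL⟩ := Skelφ.exists_mem_graphBall_φ_eq hstep t ((φL κ Φ t p O.D O.DT O.ori (gOf κ Φ t p O gv) (fOf κ Φ t p O fv)) t + yL)
  have hcLπ' : cL ∈ graphBall G t ((yL 0).natAbs + (yL 1).natAbs) := by
    simpa only [Pi.add_apply, add_sub_cancel_left] using hcLπ
  -- ### levels and the two kits of record
  have hRA := KS.RA'_eq κ Φ t p O.merged mk
  have hRl₁ : KS.RlevA κ Φ t p O.merged mk + 1 ≤ B.R' := hRA.2.1 ▸ hBR'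
  have hRl₂ : KS.RlevA κ Φ t p O.merged mk + 1 ≤ KS.RA' κ Φ t p O.merged mk := hRA.2.1.le
  have hj : KS.j₁A κ Φ t p O.merged mk ≤ KS.RlevA κ Φ t p O.merged mk := hRA.2.2
  let Pb : Skelφ.ApronPrm := KS.apron Φ t O.merged mk ((Mu O.merged : ℤ) + 2) (KS.r₀A Φ t O.merged mk Rb)
  let Pr : Skelφ.ApronPrm := KS.apron Φ t O.merged mk ((Mu O.merged + 1 : ℕ) * (shearUnit (nL κ Φ t p O.merged (gOf κ Φ t p O gv) (fOf κ Φ t p O fv)) (hL κ Φ t p O.merged (gOf κ Φ t p O gv) (fOf κ Φ t p O fv)) : ℤ) + 1) (KS.r₀A Φ t O.merged mk (O.merged.R (O.merged.scale t (ML κ Φ t p O.merged (gOf κ Φ t p O gv)) (nL κ Φ t p O.merged (gOf κ Φ t p O gv) (fOf κ Φ t p O fv)))))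
  obtain ⟨hPNb, hd1b, hD1b, hD2b, hDρb, hℓb, hWb, hKmaxb, hKCmaxb, hR'b, hTb, hT'b⟩ :=
    KS.apron_ok Φ t O.merged mk ((Mu O.merged : ℤ) + 2) (KS.r₀A Φ t O.merged mk Rb) (c := 1) (by norm_num)
  obtain ⟨hPNr, hd1r, hD1r, hD2r, hDρr, hℓr, hWr, hKmaxr, hKCmaxr, hR'r, hTr, hT'r⟩ :=
    KS.apron_ok Φ t O.merged mk ((Mu O.merged + 1 : ℕ) * (shearUnit (nL κ Φ t p O.merged (gOf κ Φ t p O gv) (fOf κ Φ t p O fv)) (hL κ Φ t p O.merged (gOf κ Φ t p O gv) (fOf κ Φ t p O fv)) : ℤ) + 1) (KS.r₀A Φ t O.merged mk (O.merged.R (O.merged.scale t (ML κ Φ t p O.merged (gOf κ Φ t p O gv)) (nL κ Φ t p O.merged (gOf κ Φ t p O gv) (fOf κ Φ t p O fv))))) (c := 11) le_rfl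
  obtain ⟨hrsb, hcSb⟩ := KS.apron_sizes Φ t O.merged mk ((Mu O.merged : ℤ) + 2) (KS.r₀A Φ t O.merged mk Rb)
  obtain ⟨hrsr, hcSr⟩ := KS.apron_sizes Φ t O.merged mk ((Mu O.merged + 1 : ℕ) * (shearUnit (nL κ Φ t p O.merged (gOf κ Φ t p O gv) (fOf κ Φ t p O fv)) (hL κ Φ t p O.merged (gOf κ Φ t p O gv) (fOf κ Φ t p O fv)) : ℤ) + 1) (KS.r₀A Φ t O.merged mk (O.merged.R (O.merged.scale t (ML κ Φ t p O.merged (gOf κ Φ t p O gv)) (nL κ Φ t p O.merged (gOf κ Φ t p O gv) (fOf κ Φ t p O fv)))))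
  have hr₀b := KS.hr₀_apron Φ t O.merged mk ((Mu O.merged : ℤ) + 2) (KS.r₀A_ge Φ t O.merged mk Rb).1
  have hr₀r := KS.hr₀_apron Φ t O.merged mk ((Mu O.merged + 1 : ℕ) * (shearUnit (nL κ Φ t p O.merged (gOf κ Φ t p O gv) (fOf κ Φ t p O fv)) (hL κ Φ t p O.merged (gOf κ Φ t p O gv) (fOf κ Φ t p O fv)) : ℤ) + 1) (KS.r₀A_ge Φ t O.merged mk (O.merged.R (O.merged.scale t (ML κ Φ t p O.merged (gOf κ Φ t p O gv)) (nL κ Φ t p O.merged (gOf κ Φ t p O gv) (fOf κ Φ t p O fv))))).1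
  have hreachb := KS.hreach_apron Φ t O.merged mk ((Mu O.merged : ℤ) + 2) (KS.r₀A_ge Φ t O.merged mk Rb).2
  have hreachr := KS.hreach_apron Φ t O.merged mk ((Mu O.merged + 1 : ℕ) * (shearUnit (nL κ Φ t p O.merged (gOf κ Φ t p O gv) (fOf κ Φ t p O fv)) (hL κ Φ t p O.merged (gOf κ Φ t p O gv) (fOf κ Φ t p O fv)) : ℤ) + 1) (KS.r₀A_ge Φ t O.merged mk (O.merged.R (O.merged.scale t (ML κ Φ t p O.merged (gOf κ Φ t p O gv)) (nL κ Φ t p O.merged (gOf κ Φ t p O gv) (fOf κ Φ t p O fv))))).2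
  have hR'b' : Skelφ.cylRadMax G (φL κ Φ t p O.D O.DT O.ori (gOf κ Φ t p O gv) (fOf κ Φ t p O fv)) Φ.types Pb.ℓ (KS.Rs t O.merged mk + KS.KCmax t O.merged mk + (Pb.W + KS.Kmax t O.merged mk)) ≤ Pb.R' := by
    unfold NegB.φL; rw [Skelφ.cylRadMax_oriφ]; exact hR'b
  have hR'r' : Skelφ.cylRadMax G (φL κ Φ t p O.D O.DT O.ori (gOf κ Φ t p O gv) (fOf κ Φ t p O fv)) Φ.types Pr.ℓ (KS.Rs t O.merged mk + KS.KCmax t O.merged mk + (Pr.W + KS.Kmax t O.merged mk)) ≤ Pr.R' := by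
    unfold NegB.φL; rw [Skelφ.cylRadMax_oriφ]; exact hR'r
  have hT₀b : tanOff Pb.ℓs Pb.M = KS.T₀a t O.merged mk := KS.tanOff_apron Φ t O.merged mk _ _
  have hT₀r : tanOff Pr.ℓs Pr.M = KS.T₀a t O.merged mk := KS.tanOff_apron Φ t O.merged mk _ _
  have hDb : Skelφ.shellD Pb = KS.Dsh t O.merged mk := KS.shellD_apron Φ t O.merged mk _ _
  have hDr : Skelφ.shellD Pr = KS.Dsh t O.merged mk := KS.shellD_apron Φ t O.merged mk _ _
  have hdb : Pb.d = KS.da t O.merged mk := rfl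
  have hdr : Pr.d = KS.da t O.merged mk := rfl
  have hwin : ∀ {lo hi : Site 2} (_ : lo ≤ hi) {j : ℕ} (_ : KS.j₀A t O.merged mk ≤ j) (X : ℤ) (_ : X ≤ 2 * (j : ℤ)) (i : Fin 2),
      (lo - (j : Site 2)) i + X ≤ (hi + (j : Site 2)) i := by
    intro lo hi hlohi j hj X hX i
    have h := hlohi i
    simp only [Pi.sub_apply, Pi.add_apply, Pi.natCast_apply]
    linarith
  have hLW := fun {j : ℕ} (hj : KS.j₀A t O.merged mk ≤ j) => KS.levels_wide t O.merged mk hj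
  have hwideb : ∀ j, KS.j₀A t O.merged mk ≤ j → j ≤ KS.j₁A κ Φ t p O.merged mk →
      ∀ i, (B.B₀lo - (j : Site 2)) i + 2 * tanOff Pb.ℓs Pb.M ≤ (B.B₀hi + (j : Site 2)) i := fun j hj _ i =>
    hwin hB.h0 hj _ (by rw [hT₀b]; exact_mod_cast (hLW hj).1) i
  have hdwb : ∀ j, KS.j₀A t O.merged mk ≤ j → j ≤ KS.j₁A κ Φ t p O.merged mk →
      ∀ i, (B.B₀lo - (j : Site 2)) i + (Pb.d + 2 : ℕ) ≤ (B.B₀hi + (j : Site 2)) i := fun j hj _ i =>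
    hwin hB.h0 hj _ (by rw [hdb]; exact_mod_cast (hLW hj).2.1) i
  have hDwb : ∀ j, KS.j₀A t O.merged mk ≤ j → j ≤ KS.j₁A κ Φ t p O.merged mk →
      ∀ i, (B.B₀lo - (j : Site 2)) i + ((Skelφ.shellD Pb + 1 + Pb.d + KS.KCmax t O.merged mk + KS.Rs t O.merged mk : ℕ) : ℤ) ≤ (B.B₀hi + (j : Site 2)) i :=
    fun j hj _ i => hwin hB.h0 hj _ (by rw [hDb, hdb]; exact_mod_cast (hLW hj).2.2) i
  let SN := xRunSched (nL κ Φ t p O.merged (gOf κ Φ t p O gv) (fOf κ Φ t p O fv)) (ℓL κ Φ t p O.merged (gOf κ Φ t p O gv) (fOf κ Φ t p O fv)) (hL κ Φ t p O.merged (gOf κ Φ t p O gv) (fOf κ Φ t p O fv)) (KS.RA' κ Φ t p O.merged mk) qB Nr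
  have hcore : ∀ k ≤ Nr + 1, SN.lo k ≤ SN.hi k := fun k hk => by
    have h := SN.nonempty k hk
    exact Finset.nonempty_Icc.1 h
  have hwider : ∀ k ≤ Nr, ∀ j, KS.j₀A t O.merged mk ≤ j → j ≤ KS.j₁A κ Φ t p O.merged mk →
      ∀ i, (SN.lo k - (j : Site 2)) i + 2 * tanOff Pr.ℓs Pr.M ≤ (SN.hi k + (j : Site 2)) i := fun k hk j hj _ i =>
    hwin (hcore k (by omega)) hj _ (by rw [hT₀r]; exact_mod_cast (hLW hj).1) i
  have hdwr : ∀ k ≤ Nr, ∀ j, KS.j₀A t O.merged mk ≤ j → j ≤ KS.j₁A κ Φ t p O.merged mk →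
      ∀ i, (SN.lo k - (j : Site 2)) i + (Pr.d + 2 : ℕ) ≤ (SN.hi k + (j : Site 2)) i := fun k hk j hj _ i =>
    hwin (hcore k (by omega)) hj _ (by rw [hdr]; exact_mod_cast (hLW hj).2.1) i
  have hDwr : ∀ k ≤ Nr, ∀ j, KS.j₀A t O.merged mk ≤ j → j ≤ KS.j₁A κ Φ t p O.merged mk →
      ∀ i, (SN.lo k - (j : Site 2)) i + ((Skelφ.shellD Pr + 1 + Pr.d + KS.KCmax t O.merged mk + KS.Rs t O.merged mk : ℕ) : ℤ) ≤ (SN.hi k + (j : Site 2)) i :=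
    fun k hk j hj _ i => hwin (hcore k (by omega)) hj _ (by rw [hDr, hdr]; exact_mod_cast (hLW hj).2.2) i
  have hEb : KS.j₁A κ Φ t p O.merged mk + (Pb.N * (tanOff Pb.ℓs Pb.M + 1) + Pb.N * Pb.d + KS.KCmax t O.merged mk) ≤ B.R' := by
    have h := KS.j_reach_le κ Φ t p O.merged mk (le_refl (KS.j₁A κ Φ t p O.merged mk))
    rw [hT₀b, hdb]; unfold KS.reachA at h
    have hN : Pb.N = 13 := rfl
    rw [hN]; omega
  have hEr : KS.j₁A κ Φ t p O.merged mk + (Pr.N * (tanOff Pr.ℓs Pr.M + 1) + Pr.N * Pr.d + KS.KCmax t O.merged mk) ≤ KS.RA' κ Φ t p O.merged mk := by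
    have h := KS.j_reach_le κ Φ t p O.merged mk (le_refl (KS.j₁A κ Φ t p O.merged mk))
    rw [hT₀r, hdr]; unfold KS.reachA at h
    have hN : Pr.N = 13 := rfl
    rw [hN]; omega
  -- counts at accuracy `δr n`
  have hδkit : Neg.δkit κ Φ ≤ κ.δr (0 + 1 + Nr) := Neg.δkit_le_δr κ Φ hNr
  obtain ⟨hk, hcount⟩ := KS.counts_R κ Φ t p O.merged mk hp0 hp1 hq1 hq2 hδkit
  have hkN : KS.kkA κ Φ t p O.merged mk * (Φ.Δ + 1) ^ (2 * KS.rsA Φ t O.merged mk) ≤ KS.NkA κ Φ t p O.merged mk :=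
    KS.hNk_at κ Φ t p O.merged mk hp0 hp1
  have hδr : 0 < κ.δr (0 + 1 + Nr) := (κ.hδr _).1
  have hδI : Neg.δI κ Φ ≤ κ.δr (0 + 1 + Nr) ^ 2 := Neg.δI_le_sq_of_le κ Φ hδkit
  have hδI' : Neg.δI κ Φ ≤ κ.δr (0 + 1 + Nr) := by
    have h1 : κ.δr (0 + 1 + Nr) ≤ 1 := (κ.hδr _).2
    have h2 : κ.δr (0 + 1 + Nr) ^ 2 ≤ κ.δr (0 + 1 + Nr) := by rw [sq]; exact mul_le_of_le_one_right hδr.le h1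
    exact hδI.trans h2
  have hηδ : Neg.η κ Φ ≤ κ.δr (0 + 1 + Nr) / 2 := by linarith [(Neg.η_pos κ Φ).2.1, hδkit]
  -- ### the kit pair's region and tables
  obtain ⟨hnSK, hκSK, hℓSK⟩ := KS.pexXO_facts_of_atQOS (g := (gOf κ Φ t p O gv)) (f := (fOf κ Φ t p O fv)) mk hAtS
  have hQKf := fun c => KS.QKO_facts κ Φ t p O.D O.DT O.ori (gOf κ Φ t p O gv) (fOf κ Φ t p O fv) mk c
  have hRgRs : ∀ c, (KS.QKO κ Φ t p O.D O.DT O.ori (gOf κ Φ t p O gv) (fOf κ Φ t p O fv) mk).RS c ≤ KS.Rs t O.merged mk := fun c => by rw [(hQKf c).2.2.2.1]; exact (KS.RK_le_Rs t O.merged mk).1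
  have hRgcard : ∀ c, (RgO G (φL κ Φ t p O.D O.DT O.ori (gOf κ Φ t p O gv) (fOf κ Φ t p O fv)) (KS.QKO κ Φ t p O.D O.DT O.ori (gOf κ Φ t p O gv) (fOf κ Φ t p O fv) mk) c).card ≤ KS.cUA Φ t O.merged mk := fun c => by
    rw [KS.RgO_QKO]; exact KS.card_RgK_le Φ t O.merged mk _ c
  have hcU1 := KS.hcU1_at Φ t O.merged mk
  -- the zone family
  have hkM : O.merged.k ≤ Mu O.merged := hkM₀
  have hkn : ∀ c, O.merged.Λ c O.merged.k ⊆ O.merged.Λ c (Mu O.merged) := fun c => by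
    rw [hΛeq]; exact Skelφ.fatSeq_monotone Φ.frame hC c hkM
  have hZφ : ∀ c, (↑(O.merged.Λ c (Mu O.merged)) : Set V) ⊆ Skelφ.cyl Φ.φ c (Mu O.merged) := fun c => by
    rw [hΛeq]; exact Skelφ.fatSeq_subset_cyl Φ.frame hC c _
  have hZ : ∀ c, (↑(O.merged.Λ c (Mu O.merged)) : Set V) ⊆ Skelφ.cyl (φL κ Φ t p O.D O.DT O.ori (gOf κ Φ t p O gv) (fOf κ Φ t p O fv)) c (Mu O.merged) := fun c => by
    unfold NegB.φL; rw [Skelφ.cyl_oriφ]; exact hZφ c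
  have hΛ : ∀ c, ∀ v ∈ O.merged.Λ c (Mu O.merged), v ∈ RgO G (φL κ Φ t p O.D O.DT O.ori (gOf κ Φ t p O gv) (fOf κ Φ t p O fv)) (KS.QKO κ Φ t p O.D O.DT O.ori (gOf κ Φ t p O gv) (fOf κ Φ t p O fv) mk) c ∧ (φL κ Φ t p O.D O.DT O.ori (gOf κ Φ t p O gv) (fOf κ Φ t p O fv)) v - (φL κ Φ t p O.D O.DT O.ori (gOf κ Φ t p O gv) (fOf κ Φ t p O fv)) c ∈ box 2 (Mu O.merged) := fun c v hv => by
    refine ⟨?_, ?_⟩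
    · rw [KS.RgO_QKO]; exact hΛRg c hv
    · exact (Skelφ.mem_cyl (φ := (φL κ Φ t p O.D O.DT O.ori (gOf κ Φ t p O gv) (fOf κ Φ t p O fv))) c (Mu O.merged) v).1 (hZ c (Finset.mem_coe.2 hv))
  have hMz : Mu O.merged < (nL κ Φ t p O.merged (gOf κ Φ t p O gv) (fOf κ Φ t p O fv)) := lt_of_le_of_lt (Mu_le_ML κ Φ t p O.merged (gOf κ Φ t p O gv)) (ML_lt_nL κ Φ t p O.merged (gOf κ Φ t p O gv) (fOf κ Φ t p O fv)).1
  -- ### the Step-I″ inputs at every centre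
  have hzone : ∀ c, 1 - κ.δr (0 + 1 + Nr) ^ 2 < (bondPercolation G S.p).real (UniqZone.zone G (O.merged.Λ c) O.merged.k (Mu O.merged)) :=
    fun c => lt_of_le_of_lt (by linarith [hδI]) (zoneAt_of_atQOB hAtB h1 c)
  -- kit pair: the table entries are served
  have hQ : ∀ c, (KS.QKO κ Φ t p O.D O.DT O.ori (gOf κ Φ t p O gv) (fOf κ Φ t p O fv) mk).nS c = KS.nKit O.merged mk ∧ (KS.QKO κ Φ t p O.D O.DT O.ori (gOf κ Φ t p O gv) (fOf κ Φ t p O fv) mk).hS c = O.merged.hgt t (KS.MK O.merged mk) (KS.nKit O.merged mk) ∧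
      (KS.QKO κ Φ t p O.D O.DT O.ori (gOf κ Φ t p O gv) (fOf κ Φ t p O fv) mk).ℓS c = O.merged.len t (KS.MK O.merged mk) (KS.nKit O.merged mk) ∧
      (KS.QKO κ Φ t p O.D O.DT O.ori (gOf κ Φ t p O gv) (fOf κ Φ t p O fv) mk).RS c = O.merged.R (O.merged.scale t (KS.MK O.merged mk) (KS.nKit O.merged mk)) ∧
      (KS.QKO κ Φ t p O.D O.DT O.ori (gOf κ Φ t p O gv) (fOf κ Φ t p O fv) mk).vS c = O.merged.spl t (KS.MK O.merged mk) (KS.nKit O.merged mk) := fun c => ⟨rfl, rfl, rfl, rfl, rfl⟩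
  have hservedK : ∀ (c : V) (fam : Fin 2) (σ' τ' : ℤˣ), 1 - κ.δr (0 + 1 + Nr) ^ 2 < (bondPercolation G q).real
      (linkIn (Skelφ.StepI.regionNAt G (oriφ (φL κ Φ t p O.D O.DT O.ori (gOf κ Φ t p O gv) (fOf κ Φ t p O fv)) ((KS.QKO κ Φ t p O.D O.DT O.ori (gOf κ Φ t p O gv) (fOf κ Φ t p O fv) mk).oS c)) O.merged t c (KS.MK O.merged mk) (KS.nKit O.merged mk))
        (O.merged.Λ c O.merged.k) (Skelφ.StepI.pieceNAt G (oriφ (φL κ Φ t p O.D O.DT O.ori (gOf κ Φ t p O gv) (fOf κ Φ t p O fv)) ((KS.QKO κ Φ t p O.D O.DT O.ori (gOf κ Φ t p O gv) (fOf κ Φ t p O fv) mk).oS c)) O.merged t c (KS.MK O.merged mk) (KS.nKit O.merged mk) fam σ' τ')) := by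
    intro c fam σ' τ'
    have h := inputsExtraAt_of_atQOB hAtB h1 c hPk fam σ' τ'
    rw [Skelφ.StepI.eventNAt_some] at h
    have hmap : oriφ (φL κ Φ t p O.D O.DT O.ori (gOf κ Φ t p O gv) (fOf κ Φ t p O fv)) ((KS.QKO κ Φ t p O.D O.DT O.ori (gOf κ Φ t p O gv) (fOf κ Φ t p O fv) mk).oS c) = oriφ Φ.φ (O.ori t (KS.MK O.merged mk) (KS.nKit O.merged mk)) := by
      rw [(hQKf c).2.2.2.2.2, KS.oriφ_φL_oS]; rfl
    rw [hmap]
    have h' : 1 - κ.δr (0 + 1 + Nr) ^ 2 ≤ 1 - Neg.δI κ Φ := by linarith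
    exact lt_of_le_of_lt h' h
  have hexitb := Skelφ.real_pexRO_gt (φ := (φL κ Φ t p O.D O.DT O.ori (gOf κ Φ t p O gv) (fOf κ Φ t p O fv))) (Λ := O.merged.Λ) (k := O.merged.k) hQ hservedK (Mu O.merged) Pb.A hσ
  have hexitr := Skelφ.real_pexXO_gt (φ := (φL κ Φ t p O.D O.DT O.ori (gOf κ Φ t p O gv) (fOf κ Φ t p O fv))) (Λ := O.merged.Λ) (k := O.merged.k) hQ hservedK (Mu O.merged) (nL κ Φ t p O.merged (gOf κ Φ t p O gv) (fOf κ Φ t p O fv)) (hL κ Φ t p O.merged (gOf κ Φ t p O gv) (fOf κ Φ t p O fv)) Pr.A hσ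
  -- the long links at every centre and the hop at the root
  have hlong : ∀ c (τ : ℤ), τ = 1 ∨ τ = -1 → 1 - κ.δr (0 + 1 + Nr) ^ 2 < (bondPercolation G S.p).real
      (linkIn (Skelφ.pgramPrism G (φL κ Φ t p O.D O.DT O.ori (gOf κ Φ t p O gv) (fOf κ Φ t p O fv)) c (nL κ Φ t p O.merged (gOf κ Φ t p O gv) (fOf κ Φ t p O fv)) (hL κ Φ t p O.merged (gOf κ Φ t p O gv) (fOf κ Φ t p O fv)) (3 * (ℓL κ Φ t p O.merged (gOf κ Φ t p O gv) (fOf κ Φ t p O fv))) (O.merged.R (O.merged.scale t (ML κ Φ t p O.merged (gOf κ Φ t p O gv)) (nL κ Φ t p O.merged (gOf κ Φ t p O gv) (fOf κ Φ t p O fv))))) (O.merged.Λ c O.merged.k) (pgSideHalfW G (φL κ Φ t p O.D O.DT O.ori (gOf κ Φ t p O gv) (fOf κ Φ t p O fv)) c (nL κ Φ t p O.merged (gOf κ Φ t p O gv) (fOf κ Φ t p O fv)) (hL κ Φ t p O.merged (gOf κ Φ t p O gv) (fOf κ Φ t p O fv)) (ℓL κ Φ t p O.merged (gOf κ Φ t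 p O gv) (fOf κ Φ t p O fv)) (O.merged.R (O.merged.scale t (ML κ Φ t p O.merged (gOf κ Φ t p O gv)) (nL κ Φ t p O.merged (gOf κ Φ t p O gv) (fOf κ Φ t p O fv)))) (sgOf du) (sgOf du * τ))) := by
    intro c τ hτ
    have hστ : sgOf du * τ = 1 ∨ sgOf du * τ = -1 := by rcases hσ with h | h <;> rcases hτ with h' | h' <;> simp [h, h']
    have h := inputsLAt_of_atQOB hAtB h1 c 0 (Skelφ.sgnU (sgOf du)) (Skelφ.sgnU (sgOf du * τ))
    rw [Skelφ.StepI.eventNAt_some] at h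
    unfold Skelφ.StepI.regionNAt Skelφ.StepI.pieceNAt at h
    rw [if_pos rfl, Skelφ.val_sgnU hσ, Skelφ.val_sgnU hστ] at h
    exact lt_of_le_of_lt (by linarith [hδI]) h
  have hlink : 1 - κ.δr (0 + 1 + Nr) < (bondPercolation G S.p).real
      (linkIn (↑(pgramPrismFin G (φL κ Φ t p O.D O.DT O.ori (gOf κ Φ t p O gv) (fOf κ Φ t p O fv)) t (nL κ Φ t p O.merged (gOf κ Φ t p O gv) (fOf κ Φ t p O fv)) (hL κ Φ t p O.merged (gOf κ Φ t p O gv) (fOf κ Φ t p O fv)) (3 * (ℓL κ Φ t p O.merged (gOf κ Φ t p O gv) (fOf κ Φ t p O fv))) (O.merged.R (O.merged.scale t (ML κ Φ t p O.merged (gOf κ Φ t p O gv)) (nL κ Φ t p O.merged (gOf κ Φ t p O gv) (fOf κ Φ t p O fv))))) : Set V) A (pgSideHalfW G (φL κ Φ t p O.D O.DT O.ori (gOf κ Φ t p O gv) (fOf κ Φ t p O fv)) t (nL κ Φ t p O.merged (gOf κ Φ t p O gv) (fOf κ Φ t p O fv)) (hL κ Φ t p O.merged (gOf κ Φ t p O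 gv) (fOf κ Φ t p O fv)) (ℓL κ Φ t p O.merged (gOf κ Φ t p O gv) (fOf κ Φ t p O fv)) (O.merged.R (O.merged.scale t (ML κ Φ t p O.merged (gOf κ Φ t p O gv)) (nL κ Φ t p O.merged (gOf κ Φ t p O gv) (fOf κ Φ t p O fv)))) (sgOf du) 1)) := by
    have h := inputsL_of_atQOS hAtS 0 (Skelφ.sgnU (sgOf du)) 1
    rw [Skelφ.StepI.eventN_some] at h
    unfold Skelφ.StepI.regionN Skelφ.StepI.pieceN at h
    rw [if_pos rfl, Skelφ.val_sgnU hσ, Units.val_one] at h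
    rw [Skelφ.StepI.coe_pgramPrismFin]
    exact lt_of_le_of_lt (by linarith [hδI']) h
  -- ### the excess radius
  -- (`hR₁_at` carries the classical instance inside `Neg.η`; the two `η`s agree by `Subsingleton.elim`)
  have hηδ' : @Neg.η κ V (fun a b => Classical.propDecidable (a = b)) _ G _ Φ ≤ κ.δr (0 + 1 + Nr) / 2 := by convert hηδ using 2
  have hR₁ := hR₁_at κ Φ (mR κ Φ t p O.merged (gOf κ Φ t p O gv) (fOf κ Φ t p O fv) mx) hCq (oL κ Φ t p O.D O.DT O.ori (gOf κ Φ t p O gv) (fOf κ Φ t p O fv)) hηδ' t (Skelφ.fatRadius Φ.frame hC O.merged.k)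
  -- ### assemble
  exact Skelφ.rootOblTWAt_of_numbers6_x hlip hstep hfr hκc Φ.degree_le S hroot du hσ hAf hnL (hL κ Φ t p O.merged (gOf κ Φ t p O gv) (fOf κ Φ t p O fv)) hmf hc0 hc1 hDf hUfoot hMfoot htA hAconn hAρ hρπ hAQ hAφ
    B hB hκL (ℓL κ Φ t p O.merged (gOf κ Φ t p O gv) (fOf κ Φ t p O fv)) (KS.RA' κ Φ t p O.merged mk) qB Nr (O.merged.R (O.merged.scale t (ML κ Φ t p O.merged (gOf κ Φ t p O gv)) (nL κ Φ t p O.merged (gOf κ Φ t p O gv) (fOf κ Φ t p O fv)))) cL hcL hcLπ'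
    (KS.RlevA κ Φ t p O.merged mk) (KS.NkA κ Φ t p O.merged mk) (KS.j₀A t O.merged mk) (KS.j₁A κ Φ t p O.merged mk)
    (KS.RlevA κ Φ t p O.merged mk) (KS.NkA κ Φ t p O.merged mk) (KS.j₀A t O.merged mk) (KS.j₁A κ Φ t p O.merged mk)
    hRl₁ hRl₂ hj hj hB0 hRlπ hΛR hEqL.1.2.2.1 hΛQ0 hΛQ1 hkR0 hkR1 hfR0 hfR1 hprism hlastc hP0 hP1 hP2 hP3 hPf₁ hPf₂ hPf₃ hL0 hL1 hL2 hL3 hLg₁ hLg₂ hLg₃ hxa hxb hclr hRn hclr₁ hπ1 hπ2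
    hδr hlink hcount hcount (le_refl _) Pb Pr (le_trans (by norm_num) hPNb) rfl hd1b hD1b hD2b hDρb hℓb hWb (by simpa using hKmaxb) (by simpa using hKCmaxb) hR'b' hwideb hdwb hDwb
    hTb hT'b hr₀b hRb₀ hrsb hcSb hEb hreachb le_rfl hRbπ hPNr rfl hd1r hD1r hD2r hDρr hℓr hWr hKmaxr hKCmaxr hR'r' hwider hdwr hDwr hTr hT'r
    hr₀r hRr₀ hrsr hcSr hEr hreachr le_rfl hRlπ (KS.QKO κ Φ t p O.D O.DT O.ori (gOf κ Φ t p O gv) (fOf κ Φ t p O fv) mk) hRgRs hRgcard hcU1 hnSK hκSK hℓSK hκL10 O.merged.Λ O.merged.k hkn hΛ hZ hMz Qb Fb hQb hFb hFZ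
    (KS.kkA κ Φ t p O.merged mk) (KS.kkA κ Φ t p O.merged mk) hkN hkN hk hk hzone hexitb hexitr hbridge hlong hUm hR₁ hR₁b hR₁r

end AtQ

end NegB

end PlanarSkeletonNeg

end Summit.CriticalPhenomena.PercolationContinuityZ3.Theorems.Transplant

end
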